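/-
Copyright (c) 2026 the pub-hodgecm-mathlib formalisation cell (harness21).  Prover seat hodgecm-mathlib-F0P3a-p04 (g18), 2026-09-02.  Road «S3-ram» seeding wave (LEAD T11-41;
owner F0P3a-p06 (g15)): row «MASS RATIO c♯ = (q+1)∕2» (JOIN constant of the :118 assembly), FILE C of 2 — the rank-one BRUHAT DATA of the vertex stabiliser `K♭`.
-/
import Literature.NumberTheory.Automorphic.UnitaryTwoEdgeStabilizerVertexAverageRamified   -- ★ p847108 (this seat, FILE B) + ★ p847088 FILE A: `E₂` bookkeeping, flip `kJ`, dichotomy, `P♯`∕`P♭ ↔` conjugated levels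
import Literature.NumberTheory.Rogawski1990.RankOneKappaVertexCoverCM                       -- ★ `isCompact_isOpen_conjGlInt_subgroupOf_unitary`, `GroupTheory.isCompact_coe_comap_continuousMulEquiv`, `…isOpen_coe_comap_of_continuous`
import HarnessLib

/-!
# The vertex stabiliser `K♭ = U ∩ D′ GL₂(𝒪_w) D′⁻¹` of ramified `U(1,1)`: its rank-one BRUHAT DATA over the Iwahori `I = K⁰ ∩ K♭`
(Tits 1979 §3.3.1, §3.9; Cartier 1979 §III.5; Serre, *Trees* II.1.3)

Topic `NumberTheory/Automorphic`; namespace `Literature.NumberTheory.Automorphic.UnitaryGroup`.  THEOREMS ONLY (no definition, no instance, no notation, no named fact,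
no `sorry`); kernel lane `--supports stmt-HodgeConjecture-24833`.  Cell `pub/hodgecm-mathlib`, crux H413; road «S3-ram» seeding wave (LEAD F0P3a-plan (g12) T11-41, owner∕table
F0P3a-p06 (g15) v2.1), row **«MASS RATIO c♯ = (q+1)∕2»** (p07 (g13) BID (2) released 23:08:59Z; owner default 23:05:52Z): the constant `ν_H(K♯ × U₁)∕ν_H(K_H)` of the second
H-column `ψ^ram 1 = 1_{K♯ × U₁}` (★ `DepthZeroTransferHValuesBasisRamified` §1, A-p16 (g31)'s χ♯ text) equals `(q+1)∕2` — the CERT's mass (B-p14 (g38) «P-1-ram profiles»).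
FILE C (this file) = the group theory; FILE D `UnitaryTwoVertexEdgeStabilizerMassRatioRamified` = the indices and measures.
HONEST LABEL: HC_CM is proved only modulo the 2 remaining named inputs (hLiu418 24832, h413 24833) until rung 0 closes; «S3-ram» is Literature seeding, count-neutral;
this file asserts nothing printed and discharges nothing by itself.

THE MATHEMATICS.  `L` CM, `w ∣ v` NON-SPLIT and TAME-RAMIFIED (`e(w|v) ≠ 1`, `|2|_w = 1`), `E₂ : U(Φ₂)(L⁺_v) ≃ₜ* U(σ_w, (Φ₂)_w)(L_w)` the one-place model, `ϖ` a uniformiser of `L_w`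
with `σ_w ϖ = −ϖ` (★ `ramifiedBlock_adicCompletion`); `K⁰ = U(Φ₂)(𝒪_v)` (★ `cmLocalIntegralLevel`), `N = N₂(L⁺_v)` (★ `cmBorelTriple.N`, the skew line `[[1, x], [0, 1]]`),
`K♭ = {g | ∀ a b, |ϖ^a ϖ^{−b} (E₂ g)_{ab}| ≤ 1}` (`= E₂⁻¹(U ∩ D′ GL₂(𝒪_w) D′⁻¹)`, `D′ = diag(ϖ, 1)`: a VERTEX stabiliser of the tree of `SL₂(L⁺_v)`) and `K♯` likewise with
`D = diag(1, ϖ)` (the other endpoint of the edge stabilised by `K⁰`).  In this file the subgroups `K♭`, `K♯` are BINDERS `(K : Subgroup U) (hK : ∀ g, g ∈ K ↔ P♭∕P♯ (E₂ g))`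
(existence §1), so every consumer's spelling (★ `exists_vertexCover_of_ramified`'s `K₂ 1`, A-p16's set-builder) is served.
* §1 `exists_subgroup_forall_mem_iff_flat∕sharp` (existence, via `Subgroup.comap E₂`), `isCompact_and_isOpen_of_forall_mem_iff_flat∕sharp` (★ `isCompact_isOpen_conjGlInt_subgroupOf_unitary`).
* §2 THE FLIP OF `K♭`: `exists_flatFlip`: `w♭ ∈ K♭` with `E₂ w♭ = [[0, ϖ], [−ϖ⁻¹, 0]]`, `E₂ w♭⁻¹ = [[0, −ϖ], [ϖ⁻¹, 0]]` (unitary BECAUSE `σϖ = −ϖ` — the one use of `hσϖ`).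
* §3 THE SKEW LINE AGAINST THE LEVELS: for `n = [[1, x], [0, 1]] ∈ N`: `n ∈ K♭ ↔ |x| ≤ |ϖ|`, `n ∈ K♯ ↔ |ϖx| ≤ 1`, and `E₂(w♭ n w♭⁻¹) = [[1, 0], [−ϖ⁻²x, 1]]`, so
  `w♭ n w♭⁻¹ ∈ K⁰ ⊓ K♭ ↔ |x| ≤ |ϖ|²` (`= exp(−2)`): the «deeper unipotents» `N_𝔭` of ★ `index_iwahori_subgroupOf_eq`.
* §4 THE ROW RELATION `κ₁₀σ(κ₁₁) + κ₁₁σ(κ₁₀) = 0` on `U(σ_w, antidiag(1,1))` (from `κ Φ ᵗσ(κ) = Φ`), whence `κ₁₁∕κ₁₀` is SKEW.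
* §5 THE BRUHAT DATA (`hBr`, `hdisj` of ★ `index_iwahori_subgroupOf_eq` for `(K♭, K⁰ ⊓ K♭, N, w♭)`): every `k ∈ K♭ ∖ K⁰` has `|(E₂k)₁₀| = |ϖ|⁻¹` and factors as
  **`k = i · w♭ · n(x)`**, `x = (E₂k)₁₁∕(E₂k)₁₀` (skew, `|x| ≤ |ϖ|`, so `n(x) ∈ N ∩ K⁰ ∩ K♭`), `i = k n(x)⁻¹ w♭⁻¹ ∈ K⁰ ∩ K♭` (entries `−det∕(ϖ(E₂k)₁₀)`, `−ϖ(E₂k)₀₀`, `0`,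
  `−ϖ(E₂k)₁₀`); and `w♭ n ∉ K⁰` for `n ∈ N ∩ K♭` (entry `−ϖ⁻¹`).  FILE D turns this into `[K♭ : K⁰ ⊓ K♭] = [N ∩ K♭ : N_𝔭] + 1 = q + 1`.

## References
* [Tits1979] J. Tits, *Reductive groups over local fields*, PSPM 33.1 (1979), §3.3.1 (Iwahori subgroups, Bruhat decomposition), §3.9.
* [CartierCorvallis1979] P. Cartier, *Representations of 𝔭-adic groups: a survey*, PSPM 33.1 (1979), §III.5 (Iwahori factorisation), §IV (4.2).
* [Serre1980Trees] J.-P. Serre, *Trees* (1980), Ch. II §1.3 (vertex and edge stabilisers in the tree of `SL₂`).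
* [Rogawski1990] J. D. Rogawski, *Automorphic Representations of Unitary Groups in Three Variables*, Ann. of Math. Stud. 123 (1990), §4.9 Lemma 4.9.3 p. 56.
-/

set_option autoImplicit false

noncomputable section

open MeasureTheory Measure Set Filter Topology NumberField IsDedekindDomain Matrix ValuativeRel
open scoped ENNReal NNReal ValuativeRel Matrix MatrixGroups

namespace Literature.NumberTheory.Automorphic.UnitaryGroup

open Literature.NumberTheory.Automorphic Literature.NumberTheory.Automorphic.HermitianLatticeTree Literature.NumberTheory.Rogawski1990

variable (L : Type) [Field L] [NumberField L] [IsCMField L] (v : HeightOneSpectrum (𝓞 ↥(maximalRealSubfield L)))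
  (w : PlacesOver L v) (hw : IsCMField.complexConj L • w.1 = w.1)
/-! ## §1 `K♭`, `K♯` as subgroups of `U(Φ₂)(L⁺_v)`: existence in the entrywise currency, compactness, openness -/

/-- Membership in the pull-back `E₂⁻¹(U ∩ D′ GL₂(𝒪_w) D′⁻¹)`, `D′ = glDiagonal ![ϖ, 1]`, is the entrywise `P♭` condition (★ FILE A `forall_v_flat_iff_coe_mem_map_conj`).
[cite: Tits1979, §3.9] -/
theorem mem_comap_localNonsplitEquiv_flat_iff (ϖ : (w.1.adicCompletion L)) (hϖ0 : ϖ ≠ 0) (g : ↥(unitaryGroupOfForm (conjLocal L (IsCMField.complexConj L) v) (cmLocalForm L 2 v))) :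
    g ∈ (Subgroup.comap (localNonsplitEquiv (IsCMField.complexConj L) (Matrix.of fun i j : Fin 2 => if i.val + j.val + 1 = 2 then (1 : L) else 0) (IsCMField.complexConj_ne_one L) w hw).toMonoidHom ((((glInt 2 (w.1.adicCompletion L)).map (MulAut.conj (glDiagonal 2 (w.1.adicCompletion L) ![Units.mk0 ϖ hϖ0, 1])).toMonoidHom).subgroupOf (unitaryGroupOfForm (galAdicCompletionMap (L := L) (IsCMField.complexConj L) hw) (placeForm (Matrix.of fun i j : Fin 2 => if i.val + j.val + 1 = 2 then (1 : L) else 0) w.1))))) ↔ (∀ a b : Fin 2, Valued.v (ϖ ^ (a : ℕ) * (ϖ ^ (b : ℕ))⁻¹ * ((((localNonsplitEquiv (IsCMField.complexConj L) (Matrix.of fun i j : Fin 2 => if i.val + j.val + 1 = 2 then (1 : L) else 0) (IsCMField.complexConj_ne_one L) w hw) g : ↥(unitaryGroupOfForm (galAdicCompletionMap (L := L) (IsCMField.complexConj L) hw) (placeForm (Matrix.of fun i j : Fin 2 => if i.val + j.val + 1 = 2 then (1 : L) else 0) w.1))) : GL (Fin 2) (w.1.adicCompletion L)) : Matrix (Fin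 2) (Fin 2) (w.1.adicCompletion L)) a b) ≤ 1) :=
  (forall_v_flat_iff_coe_mem_map_conj L w hw (Units.mk0 ϖ hϖ0) ((localNonsplitEquiv (IsCMField.complexConj L) (Matrix.of fun i j : Fin 2 => if i.val + j.val + 1 = 2 then (1 : L) else 0) (IsCMField.complexConj_ne_one L) w hw) g)).symm

/-- Membership in the pull-back `E₂⁻¹(U ∩ D GL₂(𝒪_w) D⁻¹)`, `D = glDiagonal ![1, ϖ]`, is the entrywise `P♯` condition (★ FILE A `forall_v_sharp_iff_coe_mem_map_conj`).
[cite: Tits1979, §3.9] -/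
theorem mem_comap_localNonsplitEquiv_sharp_iff (ϖ : (w.1.adicCompletion L)) (hϖ0 : ϖ ≠ 0) (g : ↥(unitaryGroupOfForm (conjLocal L (IsCMField.complexConj L) v) (cmLocalForm L 2 v))) :
    g ∈ (Subgroup.comap (localNonsplitEquiv (IsCMField.complexConj L) (Matrix.of fun i j : Fin 2 => if i.val + j.val + 1 = 2 then (1 : L) else 0) (IsCMField.complexConj_ne_one L) w hw).toMonoidHom ((((glInt 2 (w.1.adicCompletion L)).map (MulAut.conj (glDiagonal 2 (w.1.adicCompletion L) ![1, Units.mk0 ϖ hϖ0])).toMonoidHom).subgroupOf (unitaryGroupOfForm (galAdicCompletionMap (L := L) (IsCMField.complexConj L) hw) (placeForm (Matrix.of fun i j : Fin 2 => if i.val + j.val + 1 = 2 then (1 : L) else 0) w.1))))) ↔ (∀ a b : Fin 2, Valued.v (ϖ ^ (b : ℕ) * (ϖ ^ (a : ℕ))⁻¹ * ((((localNonsplitEquiv (IsCMField.complexConj L) (Matrix.of fun i j : Fin 2 => if i.val + j.val + 1 = 2 then (1 : L) else 0) (IsCMField.complexConj_ne_one L) w hw) g : ↥(unitaryGroupOfForm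 (galAdicCompletionMap (L := L) (IsCMField.complexConj L) hw) (placeForm (Matrix.of fun i j : Fin 2 => if i.val + j.val + 1 = 2 then (1 : L) else 0) w.1))) : GL (Fin 2) (w.1.adicCompletion L)) : Matrix (Fin 2) (Fin 2) (w.1.adicCompletion L)) a b) ≤ 1) :=
  (forall_v_sharp_iff_coe_mem_map_conj L w hw (Units.mk0 ϖ hϖ0) ((localNonsplitEquiv (IsCMField.complexConj L) (Matrix.of fun i j : Fin 2 => if i.val + j.val + 1 = 2 then (1 : L) else 0) (IsCMField.complexConj_ne_one L) w hw) g)).symm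

/-- **`K♭` EXISTS as a subgroup**: `∃ K ≤ U(Φ₂)(L⁺_v)`, `g ∈ K ↔ ∀ a b, |ϖ^a ϖ^{−b} (E₂g)_{ab}| ≤ 1` (the pull-back `E₂⁻¹(U ∩ D′ GL₂(𝒪_w) D′⁻¹)`, `D′ = glDiagonal ![ϖ, 1]`;
★ FILE A `forall_v_flat_iff_coe_mem_map_conj`). [cite: Tits1979, §3.9] [cite: Serre1980Trees, Ch. II §1.3] -/
theorem exists_subgroup_forall_mem_iff_flat (ϖ : (w.1.adicCompletion L)) (hϖ : Valued.v ϖ = WithZero.exp (-1 : ℤ)) :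
    ∃ K : Subgroup ↥(unitaryGroupOfForm (conjLocal L (IsCMField.complexConj L) v) (cmLocalForm L 2 v)), ∀ g : ↥(unitaryGroupOfForm (conjLocal L (IsCMField.complexConj L) v) (cmLocalForm L 2 v)), g ∈ K ↔ (∀ a b : Fin 2, Valued.v (ϖ ^ (a : ℕ) * (ϖ ^ (b : ℕ))⁻¹ * ((((localNonsplitEquiv (IsCMField.complexConj L) (Matrix.of fun i j : Fin 2 => if i.val + j.val + 1 = 2 then (1 : L) else 0) (IsCMField.complexConj_ne_one L) w hw) g : ↥(unitaryGroupOfForm (galAdicCompletionMap (L := L) (IsCMField.complexConj L) hw) (placeForm (Matrix.of fun i j : Fin 2 => if i.val + j.val + 1 = 2 then (1 : L) else 0) w.1))) : GL (Fin 2) (w.1.adicCompletion L)) : Matrix (Fin 2) (Fin 2) (w.1.adicCompletion L)) a b) ≤ 1) := by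
  have hϖ0 : ϖ ≠ 0 := (Valuation.ne_zero_iff _).1 (by rw [hϖ]; exact WithZero.exp_ne_zero)
  exact ⟨(Subgroup.comap (localNonsplitEquiv (IsCMField.complexConj L) (Matrix.of fun i j : Fin 2 => if i.val + j.val + 1 = 2 then (1 : L) else 0) (IsCMField.complexConj_ne_one L) w hw).toMonoidHom ((((glInt 2 (w.1.adicCompletion L)).map (MulAut.conj (glDiagonal 2 (w.1.adicCompletion L) ![Units.mk0 ϖ hϖ0, 1])).toMonoidHom).subgroupOf (unitaryGroupOfForm (galAdicCompletionMap (L := L) (IsCMField.complexConj L) hw) (placeForm (Matrix.of fun i j : Fin 2 => if i.val + j.val + 1 = 2 then (1 : L) else 0) w.1))))), fun g => mem_comap_localNonsplitEquiv_flat_iff L v w hw ϖ hϖ0 g⟩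

/-- **`K♯` EXISTS as a subgroup**: `∃ K ≤ U(Φ₂)(L⁺_v)`, `g ∈ K ↔ ∀ a b, |ϖ^b ϖ^{−a} (E₂g)_{ab}| ≤ 1` (`E₂⁻¹(U ∩ D GL₂(𝒪_w) D⁻¹)`, `D = glDiagonal ![1, ϖ]` — the `K₂ 1` of ★
`exists_vertexCover_of_ramified`). [cite: Tits1979, §3.9] [cite: Serre1980Trees, Ch. II §1.3] -/
theorem exists_subgroup_forall_mem_iff_sharp (ϖ : (w.1.adicCompletion L)) (hϖ : Valued.v ϖ = WithZero.exp (-1 : ℤ)) :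
    ∃ K : Subgroup ↥(unitaryGroupOfForm (conjLocal L (IsCMField.complexConj L) v) (cmLocalForm L 2 v)), ∀ g : ↥(unitaryGroupOfForm (conjLocal L (IsCMField.complexConj L) v) (cmLocalForm L 2 v)), g ∈ K ↔ (∀ a b : Fin 2, Valued.v (ϖ ^ (b : ℕ) * (ϖ ^ (a : ℕ))⁻¹ * ((((localNonsplitEquiv (IsCMField.complexConj L) (Matrix.of fun i j : Fin 2 => if i.val + j.val + 1 = 2 then (1 : L) else 0) (IsCMField.complexConj_ne_one L) w hw) g : ↥(unitaryGroupOfForm (galAdicCompletionMap (L := L) (IsCMField.complexConj L) hw) (placeForm (Matrix.of fun i j : Fin 2 => if i.val + j.val + 1 = 2 then (1 : L) else 0) w.1))) : GL (Fin 2) (w.1.adicCompletion L)) : Matrix (Fin 2) (Fin 2) (w.1.adicCompletion L)) a b) ≤ 1) := by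
  have hϖ0 : ϖ ≠ 0 := (Valuation.ne_zero_iff _).1 (by rw [hϖ]; exact WithZero.exp_ne_zero)
  exact ⟨(Subgroup.comap (localNonsplitEquiv (IsCMField.complexConj L) (Matrix.of fun i j : Fin 2 => if i.val + j.val + 1 = 2 then (1 : L) else 0) (IsCMField.complexConj_ne_one L) w hw).toMonoidHom ((((glInt 2 (w.1.adicCompletion L)).map (MulAut.conj (glDiagonal 2 (w.1.adicCompletion L) ![1, Units.mk0 ϖ hϖ0])).toMonoidHom).subgroupOf (unitaryGroupOfForm (galAdicCompletionMap (L := L) (IsCMField.complexConj L) hw) (placeForm (Matrix.of fun i j : Fin 2 => if i.val + j.val + 1 = 2 then (1 : L) else 0) w.1))))), fun g => mem_comap_localNonsplitEquiv_sharp_iff L v w hw ϖ hϖ0 g⟩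

/-- **`K♭` is compact and open** (for any subgroup with the `P♭` membership): it is the pull-back along the homeomorphism `E₂` of the compact open
`U ∩ D′ GL₂(𝒪_w) D′⁻¹` (★ `isCompact_isOpen_conjGlInt_subgroupOf_unitary`). [cite: PlatonovRapinchuk1994, §3.3] [cite: Serre1980Trees, Ch. II §1.3] -/
theorem isCompact_and_isOpen_of_forall_mem_iff_flat (ϖ : (w.1.adicCompletion L)) (hϖ : Valued.v ϖ = WithZero.exp (-1 : ℤ))
    (K : Subgroup ↥(unitaryGroupOfForm (conjLocal L (IsCMField.complexConj L) v) (cmLocalForm L 2 v))) (hK : ∀ g : ↥(unitaryGroupOfForm (conjLocal L (IsCMField.complexConj L) v) (cmLocalForm L 2 v)), g ∈ K ↔ (∀ a b : Fin 2, Valued.v (ϖ ^ (a : ℕ) * (ϖ ^ (b : ℕ))⁻¹ * ((((localNonsplitEquiv (IsCMField.complexConj L) (Matrix.of fun i j : Fin 2 => if i.val + j.val + 1 = 2 then (1 : L) else 0) (IsCMField.complexConj_ne_one L) w hw) g : ↥(unitaryGroupOfForm (galAdicCompletionMap (L := L) (IsCMField.complexConj L) hw) (placeForm (Matrix.of fun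 i j : Fin 2 => if i.val + j.val + 1 = 2 then (1 : L) else 0) w.1))) : GL (Fin 2) (w.1.adicCompletion L)) : Matrix (Fin 2) (Fin 2) (w.1.adicCompletion L)) a b) ≤ 1)) :
    IsCompact (K : Set ↥(unitaryGroupOfForm (conjLocal L (IsCMField.complexConj L) v) (cmLocalForm L 2 v))) ∧ IsOpen (K : Set ↥(unitaryGroupOfForm (conjLocal L (IsCMField.complexConj L) v) (cmLocalForm L 2 v))) := by
  have hϖ0 : ϖ ≠ 0 := (Valuation.ne_zero_iff _).1 (by rw [hϖ]; exact WithZero.exp_ne_zero)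
  have hKeq : K = (Subgroup.comap (localNonsplitEquiv (IsCMField.complexConj L) (Matrix.of fun i j : Fin 2 => if i.val + j.val + 1 = 2 then (1 : L) else 0) (IsCMField.complexConj_ne_one L) w hw).toMonoidHom ((((glInt 2 (w.1.adicCompletion L)).map (MulAut.conj (glDiagonal 2 (w.1.adicCompletion L) ![Units.mk0 ϖ hϖ0, 1])).toMonoidHom).subgroupOf (unitaryGroupOfForm (galAdicCompletionMap (L := L) (IsCMField.complexConj L) hw) (placeForm (Matrix.of fun i j : Fin 2 => if i.val + j.val + 1 = 2 then (1 : L) else 0) w.1))))) :=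
    Subgroup.ext fun g => (hK g).trans (mem_comap_localNonsplitEquiv_flat_iff L v w hw ϖ hϖ0 g).symm
  have hco := isCompact_isOpen_conjGlInt_subgroupOf_unitary L v w hw (placeForm (Matrix.of fun i j : Fin 2 => if i.val + j.val + 1 = 2 then (1 : L) else 0) w.1) (glDiagonal 2 (w.1.adicCompletion L) ![Units.mk0 ϖ hϖ0, 1])
  rw [hKeq]
  exact ⟨Literature.GroupTheory.isCompact_coe_comap_continuousMulEquiv (localNonsplitEquiv (IsCMField.complexConj L) (Matrix.of fun i j : Fin 2 => if i.val + j.val + 1 = 2 then (1 : L) else 0) (IsCMField.complexConj_ne_one L) w hw) _ hco.1,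
    Literature.GroupTheory.isOpen_coe_comap_of_continuous (localNonsplitEquiv (IsCMField.complexConj L) (Matrix.of fun i j : Fin 2 => if i.val + j.val + 1 = 2 then (1 : L) else 0) (IsCMField.complexConj_ne_one L) w hw).toMonoidHom (localNonsplitEquiv (IsCMField.complexConj L) (Matrix.of fun i j : Fin 2 => if i.val + j.val + 1 = 2 then (1 : L) else 0) (IsCMField.complexConj_ne_one L) w hw).continuous _ hco.2⟩

/-- **`K♯` is compact and open** (same, with `D = glDiagonal ![1, ϖ]`). [cite: PlatonovRapinchuk1994, §3.3] [cite: Serre1980Trees, Ch. II §1.3] -/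
theorem isCompact_and_isOpen_of_forall_mem_iff_sharp (ϖ : (w.1.adicCompletion L)) (hϖ : Valued.v ϖ = WithZero.exp (-1 : ℤ))
    (K : Subgroup ↥(unitaryGroupOfForm (conjLocal L (IsCMField.complexConj L) v) (cmLocalForm L 2 v))) (hK : ∀ g : ↥(unitaryGroupOfForm (conjLocal L (IsCMField.complexConj L) v) (cmLocalForm L 2 v)), g ∈ K ↔ (∀ a b : Fin 2, Valued.v (ϖ ^ (b : ℕ) * (ϖ ^ (a : ℕ))⁻¹ * ((((localNonsplitEquiv (IsCMField.complexConj L) (Matrix.of fun i j : Fin 2 => if i.val + j.val + 1 = 2 then (1 : L) else 0) (IsCMField.complexConj_ne_one L) w hw) g : ↥(unitaryGroupOfForm (galAdicCompletionMap (L := L) (IsCMField.complexConj L) hw) (placeForm (Matrix.of fun i j : Fin 2 => if i.val + j.val + 1 = 2 then (1 : L) else 0) w.1))) : GL (Fin 2) (w.1.adicCompletion L)) : Matrix (Fin 2) (Fin 2) (w.1.adicCompletion L)) a b) ≤ 1)) :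
    IsCompact (K : Set ↥(unitaryGroupOfForm (conjLocal L (IsCMField.complexConj L) v) (cmLocalForm L 2 v))) ∧ IsOpen (K : Set ↥(unitaryGroupOfForm (conjLocal L (IsCMField.complexConj L) v) (cmLocalForm L 2 v))) := by
  have hϖ0 : ϖ ≠ 0 := (Valuation.ne_zero_iff _).1 (by rw [hϖ]; exact WithZero.exp_ne_zero)
  have hKeq : K = (Subgroup.comap (localNonsplitEquiv (IsCMField.complexConj L) (Matrix.of fun i j : Fin 2 => if i.val + j.val + 1 = 2 then (1 : L) else 0) (IsCMField.complexConj_ne_one L) w hw).toMonoidHom ((((glInt 2 (w.1.adicCompletion L)).map (MulAut.conj (glDiagonal 2 (w.1.adicCompletion L) ![1, Units.mk0 ϖ hϖ0])).toMonoidHom).subgroupOf (unitaryGroupOfForm (galAdicCompletionMap (L := L) (IsCMField.complexConj L) hw) (placeForm (Matrix.of fun i j : Fin 2 => if i.val + j.val + 1 = 2 then (1 : L) else 0) w.1))))) :=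
    Subgroup.ext fun g => (hK g).trans (mem_comap_localNonsplitEquiv_sharp_iff L v w hw ϖ hϖ0 g).symm
  have hco := isCompact_isOpen_conjGlInt_subgroupOf_unitary L v w hw (placeForm (Matrix.of fun i j : Fin 2 => if i.val + j.val + 1 = 2 then (1 : L) else 0) w.1) (glDiagonal 2 (w.1.adicCompletion L) ![1, Units.mk0 ϖ hϖ0])
  rw [hKeq]
  exact ⟨Literature.GroupTheory.isCompact_coe_comap_continuousMulEquiv (localNonsplitEquiv (IsCMField.complexConj L) (Matrix.of fun i j : Fin 2 => if i.val + j.val + 1 = 2 then (1 : L) else 0) (IsCMField.complexConj_ne_one L) w hw) _ hco.1,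
    Literature.GroupTheory.isOpen_coe_comap_of_continuous (localNonsplitEquiv (IsCMField.complexConj L) (Matrix.of fun i j : Fin 2 => if i.val + j.val + 1 = 2 then (1 : L) else 0) (IsCMField.complexConj_ne_one L) w hw).toMonoidHom (localNonsplitEquiv (IsCMField.complexConj L) (Matrix.of fun i j : Fin 2 => if i.val + j.val + 1 = 2 then (1 : L) else 0) (IsCMField.complexConj_ne_one L) w hw).continuous _ hco.2⟩
/-! ## §2 The flip `w♭` of `K♭`: `E₂ w♭ = [[0, ϖ], [−ϖ⁻¹, 0]]` -/

/-- `[[0, ϖ], [−ϖ⁻¹, 0]] · [[0, −ϖ], [ϖ⁻¹, 0]] = 1`. [cite: Serre1980Trees, Ch. II §1.3] -/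
theorem flipMat_mul_flipMat' {F : Type*} [Field F] (ϖ : F) (hϖ0 : ϖ ≠ 0) : !![(0 : F), ϖ; -ϖ⁻¹, 0] * !![(0 : F), -ϖ; ϖ⁻¹, 0] = 1 := by
  rw [Matrix.mul_fin_two, Matrix.one_fin_two]; simp [hϖ0]

/-- `[[0, −ϖ], [ϖ⁻¹, 0]] · [[0, ϖ], [−ϖ⁻¹, 0]] = 1`. [cite: Serre1980Trees, Ch. II §1.3] -/
theorem flipMat'_mul_flipMat {F : Type*} [Field F] (ϖ : F) (hϖ0 : ϖ ≠ 0) : !![(0 : F), -ϖ; ϖ⁻¹, 0] * !![(0 : F), ϖ; -ϖ⁻¹, 0] = 1 := by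
  rw [Matrix.mul_fin_two, Matrix.one_fin_two]; simp [hϖ0]

include hw in
/-- **THE FLIP `w♭ ∈ K♭`**: an element `w♭ ∈ U(Φ₂)(L⁺_v)` with `E₂ w♭ = [[0, ϖ], [−ϖ⁻¹, 0]]`, `E₂ w♭⁻¹ = [[0, −ϖ], [ϖ⁻¹, 0]]`, lying in `K♭` — unitary for `antidiag(1,1)` because
`σϖ = −ϖ`.  (It maps the edge of `K⁰` to another edge at the vertex of `K♭`.) [cite: Tits1979, §3.3.1, §3.9] [cite: Serre1980Trees, Ch. II §1.3] -/
theorem exists_flatFlip (ϖ : (w.1.adicCompletion L)) (hϖ : Valued.v ϖ = WithZero.exp (-1 : ℤ)) (hσϖ : (galAdicCompletionMap (L := L) (IsCMField.complexConj L) hw) ϖ = -ϖ)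
    (K : Subgroup ↥(unitaryGroupOfForm (conjLocal L (IsCMField.complexConj L) v) (cmLocalForm L 2 v))) (hK : ∀ g : ↥(unitaryGroupOfForm (conjLocal L (IsCMField.complexConj L) v) (cmLocalForm L 2 v)), g ∈ K ↔ (∀ a b : Fin 2, Valued.v (ϖ ^ (a : ℕ) * (ϖ ^ (b : ℕ))⁻¹ * ((((localNonsplitEquiv (IsCMField.complexConj L) (Matrix.of fun i j : Fin 2 => if i.val + j.val + 1 = 2 then (1 : L) else 0) (IsCMField.complexConj_ne_one L) w hw) g : ↥(unitaryGroupOfForm (galAdicCompletionMap (L := L) (IsCMField.complexConj L) hw) (placeForm (Matrix.of fun i j : Fin 2 => if i.val + j.val + 1 = 2 then (1 : L) else 0) w.1))) : GL (Fin 2) (w.1.adicCompletion L)) : Matrix (Fin 2) (Fin 2) (w.1.adicCompletion L)) a b) ≤ 1)) :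
    ∃ wf : ↥(unitaryGroupOfForm (conjLocal L (IsCMField.complexConj L) v) (cmLocalForm L 2 v)), wf ∈ K ∧ ((((localNonsplitEquiv (IsCMField.complexConj L) (Matrix.of fun i j : Fin 2 => if i.val + j.val + 1 = 2 then (1 : L) else 0) (IsCMField.complexConj_ne_one L) w hw) wf : ↥(unitaryGroupOfForm (galAdicCompletionMap (L := L) (IsCMField.complexConj L) hw) (placeForm (Matrix.of fun i j : Fin 2 => if i.val + j.val + 1 = 2 then (1 : L) else 0) w.1))) : GL (Fin 2) (w.1.adicCompletion L)) : Matrix (Fin 2) (Fin 2) (w.1.adicCompletion L)) = !![(0 : (w.1.adicCompletion L)), ϖ; -ϖ⁻¹, 0] ∧ ((((localNonsplitEquiv (IsCMField.complexConj L) (Matrix.of fun i j : Fin 2 => if i.val + j.val + 1 = 2 then (1 : L) else 0) (IsCMField.complexConj_ne_one L) w hw) (wf⁻¹ : ↥(unitaryGroupOfForm (conjLocal L (IsCMField.complexConj L) v) (cmLocalForm L 2 v))) : ↥(unitaryGroupOfForm (galAdicCompletionMap (L := L) (IsCMField.complexConj L) hw) (placeForm (Matrix.of fun i j : Fin 2 =>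 if i.val + j.val + 1 = 2 then (1 : L) else 0) w.1))) : GL (Fin 2) (w.1.adicCompletion L)) : Matrix (Fin 2) (Fin 2) (w.1.adicCompletion L)) = !![(0 : (w.1.adicCompletion L)), -ϖ; ϖ⁻¹, 0] := by
  have hϖ0 : ϖ ≠ 0 := (Valuation.ne_zero_iff _).1 (by rw [hϖ]; exact WithZero.exp_ne_zero)
  obtain ⟨Wgl, hWcoe, hWinv⟩ : ∃ Wgl : GL (Fin 2) (w.1.adicCompletion L), (Wgl : Matrix (Fin 2) (Fin 2) (w.1.adicCompletion L)) = !![(0 : (w.1.adicCompletion L)), ϖ; -ϖ⁻¹, 0] ∧ ((Wgl⁻¹ : GL (Fin 2) (w.1.adicCompletion L)) : Matrix (Fin 2) (Fin 2) (w.1.adicCompletion L)) = !![(0 : (w.1.adicCompletion L)), -ϖ; ϖ⁻¹, 0] :=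
    ⟨⟨!![(0 : (w.1.adicCompletion L)), ϖ; -ϖ⁻¹, 0], !![(0 : (w.1.adicCompletion L)), -ϖ; ϖ⁻¹, 0], flipMat_mul_flipMat' ϖ hϖ0, flipMat'_mul_flipMat ϖ hϖ0⟩, rfl, rfl⟩
  have hσinv : (galAdicCompletionMap (L := L) (IsCMField.complexConj L) hw) ϖ⁻¹ = -ϖ⁻¹ := by rw [map_inv₀, hσϖ, inv_neg]
  have hmapW : (!![(0 : (w.1.adicCompletion L)), ϖ; -ϖ⁻¹, 0]).map (galAdicCompletionMap (L := L) (IsCMField.complexConj L) hw) = !![(0 : (w.1.adicCompletion L)), -ϖ; ϖ⁻¹, 0] := by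
    ext i j; fin_cases i <;> fin_cases j <;> simp [hσϖ, hσinv]
  have hWU : Wgl ∈ (unitaryGroupOfForm (galAdicCompletionMap (L := L) (IsCMField.complexConj L) hw) (placeForm (Matrix.of fun i j : Fin 2 => if i.val + j.val + 1 = 2 then (1 : L) else 0) w.1)) := by
    rw [placeForm_antidiagTwo_eq, mem_unitaryGroupOfForm_iff, hWcoe, hmapW]
    ext i j; fin_cases i <;> fin_cases j <;> simp [Matrix.mul_apply, Fin.sum_univ_two, hϖ0]
  have hE : (((localNonsplitEquiv (IsCMField.complexConj L) (Matrix.of fun i j : Fin 2 => if i.val + j.val + 1 = 2 then (1 : L) else 0) (IsCMField.complexConj_ne_one L) w hw) ((localNonsplitEquiv (IsCMField.complexConj L) (Matrix.of fun i j : Fin 2 => if i.val + j.val + 1 = 2 then (1 : L) else 0) (IsCMField.complexConj_ne_one L) w hw).symm ⟨Wgl, hWU⟩) : ↥(unitaryGroupOfForm (galAdicCompletionMap (L := L) (IsCMField.complexConj L) hw) (placeForm (Matrix.of fun i j : Fin 2 => if i.val + j.val + 1 = 2 then (1 : L) else 0) w.1))) : GL (Fin 2) (w.1.adicCompletion L))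 = Wgl :=
    congrArg (fun x : ↥(unitaryGroupOfForm (galAdicCompletionMap (L := L) (IsCMField.complexConj L) hw) (placeForm (Matrix.of fun i j : Fin 2 => if i.val + j.val + 1 = 2 then (1 : L) else 0) w.1)) => (x : GL (Fin 2) (w.1.adicCompletion L))) (ContinuousMulEquiv.apply_symm_apply (localNonsplitEquiv (IsCMField.complexConj L) (Matrix.of fun i j : Fin 2 => if i.val + j.val + 1 = 2 then (1 : L) else 0) (IsCMField.complexConj_ne_one L) w hw) ⟨Wgl, hWU⟩)
  refine ⟨(localNonsplitEquiv (IsCMField.complexConj L) (Matrix.of fun i j : Fin 2 => if i.val + j.val + 1 = 2 then (1 : L) else 0) (IsCMField.complexConj_ne_one L) w hw).symm ⟨Wgl, hWU⟩, ?_, ?_, ?_⟩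
  · rw [hK, hE, hWcoe]
    intro a b
    fin_cases a <;> fin_cases b <;> simp [hϖ0]
  · rw [hE, hWcoe]
  · rw [coe_localNonsplitEquiv_inv, hE, hWinv]
/-! ## §3 The skew line `N = [[1, x], [0, 1]]` against `K⁰`, `K♭`, `K♯`, and its `w♭`-conjugate -/

include hw in
/-- **`g ∈ K⁰ ↔` all entries of `E₂ g` are integral** (★ `mem_localIntegralLevel_iff_of_smul_eq` + ★ `coe_mem_glInt_iff_forall_v_le_one`). [cite: Rogawski1990, §4.9 p. 55] -/
theorem mem_cmLocalIntegralLevel_iff_forall_v_coe_localNonsplitEquiv_le_one (g : ↥(unitaryGroupOfForm (conjLocal L (IsCMField.complexConj L) v) (cmLocalForm L 2 v))) :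
    g ∈ (cmLocalIntegralLevel L 2 (Matrix.of fun i j : Fin 2 => if i.val + j.val + 1 = 2 then (1 : L) else 0) v : Subgroup ↥(unitaryGroupOfForm (conjLocal L (IsCMField.complexConj L) v) (cmLocalForm L 2 v))) ↔ ∀ i j : Fin 2, Valued.v (((((localNonsplitEquiv (IsCMField.complexConj L) (Matrix.of fun i j : Fin 2 => if i.val + j.val + 1 = 2 then (1 : L) else 0) (IsCMField.complexConj_ne_one L) w hw) g : ↥(unitaryGroupOfForm (galAdicCompletionMap (L := L) (IsCMField.complexConj L) hw) (placeForm (Matrix.of fun i j : Fin 2 => if i.val + j.val + 1 = 2 then (1 : L) else 0) w.1))) : GL (Fin 2) (w.1.adicCompletion L)) : Matrix (Fin 2) (Fin 2) (w.1.adicCompletion L)) i j) ≤ 1 :=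
  (mem_localIntegralLevel_iff_of_smul_eq (IsCMField.complexConj L) 2 (Matrix.of fun i j : Fin 2 => if i.val + j.val + 1 = 2 then (1 : L) else 0) (IsCMField.complexConj_ne_one L) w hw g).trans
    (coe_mem_glInt_iff_forall_v_le_one L w hw _)

/-- `E₂ n = [[1, x_n], [0, 1]]` for `n ∈ N` (★ `map_coe_unipotent_two`, read through the one-place model). [cite: Rogawski1990, §1.10 p. 9] -/
theorem coe_localNonsplitEquiv_unipotent (n : ↥(cmBorelTriple L 2 v).N) : ((((localNonsplitEquiv (IsCMField.complexConj L) (Matrix.of fun i j : Fin 2 => if i.val + j.val + 1 = 2 then (1 : L) else 0) (IsCMField.complexConj_ne_one L) w hw) ((n : ↥(cmBorelTriple L 2 v).N) : ↥(unitaryGroupOfForm (conjLocal L (IsCMField.complexConj L) v) (cmLocalForm L 2 v))) : ↥(unitaryGroupOfForm (galAdicCompletionMap (L := L) (IsCMField.complexConj L) hw) (placeForm (Matrix.of fun i j : Fin 2 => if i.val + j.val + 1 = 2 then (1 : L) else 0) w.1))) : GL (Fin 2) (w.1.adicCompletion L)) : Matrix (Fin 2) (Fin 2) (w.1.adicCompletion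 L)) = !![(1 : (w.1.adicCompletion L)), ((((n : ↥(cmBorelTriple L 2 v).N) : ↥(unitaryGroupOfForm (conjLocal L (IsCMField.complexConj L) v) (cmLocalForm L 2 v))) : GL (Fin 2) (LocalRing L v)) : Matrix (Fin 2) (Fin 2) (LocalRing L v)) 0 1 w; 0, 1] :=
  map_coe_unipotent_two L v w n

/-- `E₂ n⁻¹ = [[1, −x_n], [0, 1]]` for `n ∈ N`. [cite: Rogawski1990, §1.10 p. 9] -/
theorem coe_localNonsplitEquiv_unipotent_inv (n : ↥(cmBorelTriple L 2 v).N) : ((((localNonsplitEquiv (IsCMField.complexConj L) (Matrix.of fun i j : Fin 2 => if i.val + j.val + 1 = 2 then (1 : L) else 0) (IsCMField.complexConj_ne_one L) w hw) ((((n : ↥(cmBorelTriple L 2 v).N) : ↥(unitaryGroupOfForm (conjLocal L (IsCMField.complexConj L) v) (cmLocalForm L 2 v))))⁻¹ : ↥(unitaryGroupOfForm (conjLocal L (IsCMField.complexConj L) v) (cmLocalForm L 2 v))) : ↥(unitaryGroupOfForm (galAdicCompletionMap (L := L) (IsCMField.complexConj L) hw) (placeForm (Matrix.of fun i j : Fin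 2 => if i.val + j.val + 1 = 2 then (1 : L) else 0) w.1))) : GL (Fin 2) (w.1.adicCompletion L)) : Matrix (Fin 2) (Fin 2) (w.1.adicCompletion L)) = !![(1 : (w.1.adicCompletion L)), -((((n : ↥(cmBorelTriple L 2 v).N) : ↥(unitaryGroupOfForm (conjLocal L (IsCMField.complexConj L) v) (cmLocalForm L 2 v))) : GL (Fin 2) (LocalRing L v)) : Matrix (Fin 2) (Fin 2) (LocalRing L v)) 0 1 w; 0, 1] := by
  have h : ((((localNonsplitEquiv (IsCMField.complexConj L) (Matrix.of fun i j : Fin 2 => if i.val + j.val + 1 = 2 then (1 : L) else 0) (IsCMField.complexConj_ne_one L) w hw) ((((n : ↥(cmBorelTriple L 2 v).N) : ↥(unitaryGroupOfForm (conjLocal L (IsCMField.complexConj L) v) (cmLocalForm L 2 v))))⁻¹ : ↥(unitaryGroupOfForm (conjLocal L (IsCMField.complexConj L) v) (cmLocalForm L 2 v))) : ↥(unitaryGroupOfForm (galAdicCompletionMap (L := L) (IsCMField.complexConj L) hw) (placeForm (Matrix.of fun i j : Fin 2 => if i.val + j.val + 1 = 2 then (1 : L) else 0) w.1))) : GL (Fin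 2) (w.1.adicCompletion L)) : Matrix (Fin 2) (Fin 2) (w.1.adicCompletion L)) = ((((localNonsplitEquiv (IsCMField.complexConj L) (Matrix.of fun i j : Fin 2 => if i.val + j.val + 1 = 2 then (1 : L) else 0) (IsCMField.complexConj_ne_one L) w hw) ((n⁻¹ : ↥(cmBorelTriple L 2 v).N) : ↥(unitaryGroupOfForm (conjLocal L (IsCMField.complexConj L) v) (cmLocalForm L 2 v))) : ↥(unitaryGroupOfForm (galAdicCompletionMap (L := L) (IsCMField.complexConj L) hw) (placeForm (Matrix.of fun i j : Fin 2 => if i.val + j.val + 1 = 2 then (1 : L) else 0) w.1))) : GL (Fin 2) (w.1.adicCompletion L)) : Matrix (Fin 2) (Fin 2) (w.1.adicCompletion L)) := rfl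
  rw [h, coe_localNonsplitEquiv_unipotent, LineRing.umat_inv_zero_one_two]
  rfl

/-- **`n ∈ K♭ ↔ |x_n| ≤ |ϖ|`** for `n = [[1, x_n], [0, 1]] ∈ N` (the only non-trivial `P♭` entry is `|ϖ⁻¹ x_n| ≤ 1`). [cite: Tits1979, §3.9] -/
theorem flat_coe_unipotent_iff (ϖ : (w.1.adicCompletion L)) (hϖ : Valued.v ϖ = WithZero.exp (-1 : ℤ)) (n : ↥(cmBorelTriple L 2 v).N) :
    (∀ a b : Fin 2, Valued.v (ϖ ^ (a : ℕ) * (ϖ ^ (b : ℕ))⁻¹ * ((((localNonsplitEquiv (IsCMField.complexConj L) (Matrix.of fun i j : Fin 2 => if i.val + j.val + 1 = 2 then (1 : L) else 0) (IsCMField.complexConj_ne_one L) w hw) ((n : ↥(cmBorelTriple L 2 v).N) : ↥(unitaryGroupOfForm (conjLocal L (IsCMField.complexConj L) v) (cmLocalForm L 2 v))) : ↥(unitaryGroupOfForm (galAdicCompletionMap (L := L) (IsCMField.complexConj L) hw) (placeForm (Matrix.of fun i j : Fin 2 => if i.val + j.val + 1 = 2 then (1 : L) else 0) w.1))) : GL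 (Fin 2) (w.1.adicCompletion L)) : Matrix (Fin 2) (Fin 2) (w.1.adicCompletion L)) a b) ≤ 1) ↔ Valued.v (((((n : ↥(cmBorelTriple L 2 v).N) : ↥(unitaryGroupOfForm (conjLocal L (IsCMField.complexConj L) v) (cmLocalForm L 2 v))) : GL (Fin 2) (LocalRing L v)) : Matrix (Fin 2) (Fin 2) (LocalRing L v)) 0 1 w) ≤ Valued.v ϖ := by
  have hϖ0 : ϖ ≠ 0 := (Valuation.ne_zero_iff _).1 (by rw [hϖ]; exact WithZero.exp_ne_zero)
  have hvϖ : 0 < Valued.v ϖ := (Valuation.pos_iff _).2 hϖ0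
  have hkey : Valued.v (ϖ⁻¹ * ((((n : ↥(cmBorelTriple L 2 v).N) : ↥(unitaryGroupOfForm (conjLocal L (IsCMField.complexConj L) v) (cmLocalForm L 2 v))) : GL (Fin 2) (LocalRing L v)) : Matrix (Fin 2) (Fin 2) (LocalRing L v)) 0 1 w) ≤ 1 ↔ Valued.v (((((n : ↥(cmBorelTriple L 2 v).N) : ↥(unitaryGroupOfForm (conjLocal L (IsCMField.complexConj L) v) (cmLocalForm L 2 v))) : GL (Fin 2) (LocalRing L v)) : Matrix (Fin 2) (Fin 2) (LocalRing L v)) 0 1 w) ≤ Valued.v ϖ := by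
    rw [Valuation.map_mul, map_inv₀, inv_mul_le_iff₀ hvϖ, mul_one]
  rw [coe_localNonsplitEquiv_unipotent]
  constructor
  · intro h
    have h01 := h 0 1
    simp only [Fin.isValue, Fin.val_zero, Fin.val_one, pow_zero, pow_one, one_mul, Matrix.of_apply, Matrix.cons_val', Matrix.cons_val_zero,
      Matrix.cons_val_one, Matrix.cons_val_fin_one, Matrix.empty_val'] at h01
    exact hkey.1 h01
  · intro h a b
    fin_cases a <;> fin_cases b
    · simp
    · simpa using hkey.2 h
    · simp
    · simp [hϖ0]

/-- **`n ∈ K♯ ↔ |ϖ x_n| ≤ 1`** for `n = [[1, x_n], [0, 1]] ∈ N`. [cite: Tits1979, §3.9] -/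
theorem sharp_coe_unipotent_iff (ϖ : (w.1.adicCompletion L)) (hϖ : Valued.v ϖ = WithZero.exp (-1 : ℤ)) (n : ↥(cmBorelTriple L 2 v).N) :
    (∀ a b : Fin 2, Valued.v (ϖ ^ (b : ℕ) * (ϖ ^ (a : ℕ))⁻¹ * ((((localNonsplitEquiv (IsCMField.complexConj L) (Matrix.of fun i j : Fin 2 => if i.val + j.val + 1 = 2 then (1 : L) else 0) (IsCMField.complexConj_ne_one L) w hw) ((n : ↥(cmBorelTriple L 2 v).N) : ↥(unitaryGroupOfForm (conjLocal L (IsCMField.complexConj L) v) (cmLocalForm L 2 v))) : ↥(unitaryGroupOfForm (galAdicCompletionMap (L := L) (IsCMField.complexConj L) hw) (placeForm (Matrix.of fun i j : Fin 2 => if i.val + j.val + 1 = 2 then (1 : L) else 0) w.1))) : GL (Fin 2) (w.1.adicCompletion L)) : Matrix (Fin 2) (Fin 2) (w.1.adicCompletion L)) a b) ≤ 1) ↔ Valued.v (ϖ * ((((n : ↥(cmBorelTriple L 2 v).N) : ↥(unitaryGroupOfForm (conjLocal L (IsCMField.complexConj L) v) (cmLocalForm L 2 v))) : GL (Fin 2)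 (LocalRing L v)) : Matrix (Fin 2) (Fin 2) (LocalRing L v)) 0 1 w) ≤ 1 := by
  have hϖ0 : ϖ ≠ 0 := (Valuation.ne_zero_iff _).1 (by rw [hϖ]; exact WithZero.exp_ne_zero)
  rw [coe_localNonsplitEquiv_unipotent]
  constructor
  · intro h
    have h01 := h 0 1
    simp only [Fin.isValue, Fin.val_zero, Fin.val_one, pow_zero, pow_one, inv_one, mul_one, Matrix.of_apply, Matrix.cons_val', Matrix.cons_val_zero,
      Matrix.cons_val_one, Matrix.cons_val_fin_one, Matrix.empty_val'] at h01
    exact h01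
  · intro h a b
    fin_cases a <;> fin_cases b
    · simp
    · simpa using h
    · simp
    · simp [hϖ0]

include hw in
/-- **AT A TAME-RAMIFIED `w`: `n ∈ K♭ ↔ n ∈ K⁰` for `n ∈ N`** — the integral skew line lies in `𝔪_w` (★ `valued_skew_apply_lt_one_of_ramified`), so `|x_n| ≤ 1 ↔ |x_n| ≤ |ϖ|`.
[cite: Serre1979, Ch. I §7–§8] [cite: Tits1979, §3.9] -/
theorem flat_coe_unipotent_iff_mem_cmLocalIntegralLevel (he : v.asIdeal.ramificationIdx' w.1.asIdeal ≠ 1) (h2w : Valued.v (2 : (w.1.adicCompletion L)) = 1)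
    (ϖ : (w.1.adicCompletion L)) (hϖ : Valued.v ϖ = WithZero.exp (-1 : ℤ)) (n : ↥(cmBorelTriple L 2 v).N) :
    (∀ a b : Fin 2, Valued.v (ϖ ^ (a : ℕ) * (ϖ ^ (b : ℕ))⁻¹ * ((((localNonsplitEquiv (IsCMField.complexConj L) (Matrix.of fun i j : Fin 2 => if i.val + j.val + 1 = 2 then (1 : L) else 0) (IsCMField.complexConj_ne_one L) w hw) ((n : ↥(cmBorelTriple L 2 v).N) : ↥(unitaryGroupOfForm (conjLocal L (IsCMField.complexConj L) v) (cmLocalForm L 2 v))) : ↥(unitaryGroupOfForm (galAdicCompletionMap (L := L) (IsCMField.complexConj L) hw) (placeForm (Matrix.of fun i j : Fin 2 => if i.val + j.val + 1 = 2 then (1 : L) else 0) w.1))) : GL (Fin 2) (w.1.adicCompletion L)) : Matrix (Fin 2) (Fin 2) (w.1.adicCompletion L)) a b) ≤ 1) ↔ ((n : ↥(cmBorelTriple L 2 v).N) : ↥(unitaryGroupOfForm (conjLocal L (IsCMField.complexConj L) v) (cmLocalForm L 2 v))) ∈ (cmLocalIntegralLevel L 2 (Matrix.of fun i j : Fin 2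 => if i.val + j.val + 1 = 2 then (1 : L) else 0) v : Subgroup ↥(unitaryGroupOfForm (conjLocal L (IsCMField.complexConj L) v) (cmLocalForm L 2 v))) := by
  rw [flat_coe_unipotent_iff L v w hw ϖ hϖ, unipotent_mem_cmLocalIntegralLevel_iff L v w hw n, hϖ]
  have hle : ∀ {x : WithZero (Multiplicative ℤ)}, x < 1 → x ≤ WithZero.exp (-1 : ℤ) := fun hx => by
    rw [← WithZero.lt_mul_exp_iff_le WithZero.exp_ne_zero, ← WithZero.exp_add]; simpa using hx
  have hϖ1 : WithZero.exp (-1 : ℤ) ≤ 1 := by rw [← WithZero.exp_zero, WithZero.exp_le_exp]; norm_num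
  refine ⟨fun h => h.trans hϖ1, fun h => hle ?_⟩
  exact valued_skew_apply_lt_one_of_ramified L v w hw he h2w ⟨_, LineRing.umat_zero_one_mem_skewPart (conjLocal L (IsCMField.complexConj L) v) (cmLocalForm_eq_over L 2 v) n⟩ h

/-- **`E₂(w♭ n w♭⁻¹) = [[1, 0], [−ϖ⁻² x_n, 1]]`** for `n = [[1, x_n], [0, 1]] ∈ N` (the flip turns the upper skew line into the lower one, two steps deeper).
[cite: Tits1979, §3.3.1] [cite: CartierCorvallis1979, §III.5] -/
theorem coe_localNonsplitEquiv_flip_conj_unipotent (ϖ : (w.1.adicCompletion L)) (hϖ : Valued.v ϖ = WithZero.exp (-1 : ℤ))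
    (wf : ↥(unitaryGroupOfForm (conjLocal L (IsCMField.complexConj L) v) (cmLocalForm L 2 v))) (hwf : ((((localNonsplitEquiv (IsCMField.complexConj L) (Matrix.of fun i j : Fin 2 => if i.val + j.val + 1 = 2 then (1 : L) else 0) (IsCMField.complexConj_ne_one L) w hw) wf : ↥(unitaryGroupOfForm (galAdicCompletionMap (L := L) (IsCMField.complexConj L) hw) (placeForm (Matrix.of fun i j : Fin 2 => if i.val + j.val + 1 = 2 then (1 : L) else 0) w.1))) : GL (Fin 2) (w.1.adicCompletion L)) : Matrix (Fin 2) (Fin 2) (w.1.adicCompletion L)) = !![(0 : (w.1.adicCompletion L)), ϖ; -ϖ⁻¹, 0]) (hwf' : ((((localNonsplitEquiv (IsCMField.complexConj L) (Matrix.of fun i j : Fin 2 => if i.val + j.val + 1 = 2 then (1 : L) else 0) (IsCMField.complexConj_ne_one L) w hw) (wf⁻¹ : ↥(unitaryGroupOfForm (conjLocal L (IsCMField.complexConj L) v) (cmLocalForm L 2 v))) : ↥(unitaryGroupOfForm (galAdicCompletionMap (L := L) (IsCMField.complexConj L) hw) (placeForm (Matrix.of fun i j : Fin 2 => if i.val +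 j.val + 1 = 2 then (1 : L) else 0) w.1))) : GL (Fin 2) (w.1.adicCompletion L)) : Matrix (Fin 2) (Fin 2) (w.1.adicCompletion L)) = !![(0 : (w.1.adicCompletion L)), -ϖ; ϖ⁻¹, 0]) (n : ↥(cmBorelTriple L 2 v).N) :
    ((((localNonsplitEquiv (IsCMField.complexConj L) (Matrix.of fun i j : Fin 2 => if i.val + j.val + 1 = 2 then (1 : L) else 0) (IsCMField.complexConj_ne_one L) w hw) (wf * ((n : ↥(cmBorelTriple L 2 v).N) : ↥(unitaryGroupOfForm (conjLocal L (IsCMField.complexConj L) v) (cmLocalForm L 2 v))) * wf⁻¹) : ↥(unitaryGroupOfForm (galAdicCompletionMap (L := L) (IsCMField.complexConj L) hw) (placeForm (Matrix.of fun i j : Fin 2 => if i.val + j.val + 1 = 2 then (1 : L) else 0) w.1))) : GL (Fin 2) (w.1.adicCompletion L)) : Matrix (Fin 2) (Fin 2) (w.1.adicCompletion L)) = !![(1 : (w.1.adicCompletion L)), 0; -(ϖ⁻¹ * ((((n : ↥(cmBorelTriple L 2 v).N) : ↥(unitaryGroupOfForm (conjLocal L (IsCMField.complexConj L) v) (cmLocalForm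 L 2 v))) : GL (Fin 2) (LocalRing L v)) : Matrix (Fin 2) (Fin 2) (LocalRing L v)) 0 1 w * ϖ⁻¹), 1] := by
  have hϖ0 : ϖ ≠ 0 := (Valuation.ne_zero_iff _).1 (by rw [hϖ]; exact WithZero.exp_ne_zero)
  rw [coe_localNonsplitEquiv_mul, coe_localNonsplitEquiv_mul, Units.val_mul, Units.val_mul, hwf, hwf', coe_localNonsplitEquiv_unipotent,
    Matrix.mul_fin_two, Matrix.mul_fin_two]
  ext i j; fin_cases i <;> fin_cases j
  · simp [hϖ0]
  · simp
  · simp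
  · simp [hϖ0]

include hw in
/-- **`w♭ n w♭⁻¹ ∈ K⁰ ↔ |x_n| ≤ |ϖ²|`** (the lower entry `−ϖ⁻² x_n` is integral). [cite: Tits1979, §3.3.1] [cite: CartierCorvallis1979, §III.5] -/
theorem flip_conj_unipotent_mem_cmLocalIntegralLevel_iff (ϖ : (w.1.adicCompletion L)) (hϖ : Valued.v ϖ = WithZero.exp (-1 : ℤ))
    (wf : ↥(unitaryGroupOfForm (conjLocal L (IsCMField.complexConj L) v) (cmLocalForm L 2 v))) (hwf : ((((localNonsplitEquiv (IsCMField.complexConj L) (Matrix.of fun i j : Fin 2 => if i.val + j.val + 1 = 2 then (1 : L) else 0) (IsCMField.complexConj_ne_one L) w hw) wf : ↥(unitaryGroupOfForm (galAdicCompletionMap (L := L) (IsCMField.complexConj L) hw) (placeForm (Matrix.of fun i j : Fin 2 => if i.val + j.val + 1 = 2 then (1 : L) else 0) w.1))) : GL (Fin 2) (w.1.adicCompletion L)) : Matrix (Fin 2) (Fin 2) (w.1.adicCompletion L)) = !![(0 : (w.1.adicCompletion L)), ϖ; -ϖ⁻¹, 0]) (hwf' : ((((localNonsplitEquiv (IsCMField.complexConj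 L) (Matrix.of fun i j : Fin 2 => if i.val + j.val + 1 = 2 then (1 : L) else 0) (IsCMField.complexConj_ne_one L) w hw) (wf⁻¹ : ↥(unitaryGroupOfForm (conjLocal L (IsCMField.complexConj L) v) (cmLocalForm L 2 v))) : ↥(unitaryGroupOfForm (galAdicCompletionMap (L := L) (IsCMField.complexConj L) hw) (placeForm (Matrix.of fun i j : Fin 2 => if i.val + j.val + 1 = 2 then (1 : L) else 0) w.1))) : GL (Fin 2) (w.1.adicCompletion L)) : Matrix (Fin 2) (Fin 2) (w.1.adicCompletion L)) = !![(0 : (w.1.adicCompletion L)), -ϖ; ϖ⁻¹, 0]) (n : ↥(cmBorelTriple L 2 v).N) :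
    wf * ((n : ↥(cmBorelTriple L 2 v).N) : ↥(unitaryGroupOfForm (conjLocal L (IsCMField.complexConj L) v) (cmLocalForm L 2 v))) * wf⁻¹ ∈ (cmLocalIntegralLevel L 2 (Matrix.of fun i j : Fin 2 => if i.val + j.val + 1 = 2 then (1 : L) else 0) v : Subgroup ↥(unitaryGroupOfForm (conjLocal L (IsCMField.complexConj L) v) (cmLocalForm L 2 v))) ↔ Valued.v (((((n : ↥(cmBorelTriple L 2 v).N) : ↥(unitaryGroupOfForm (conjLocal L (IsCMField.complexConj L) v) (cmLocalForm L 2 v))) : GL (Fin 2) (LocalRing L v)) : Matrix (Fin 2) (Fin 2) (LocalRing L v)) 0 1 w) ≤ Valued.v (ϖ ^ 2) := by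
  have hϖ0 : ϖ ≠ 0 := (Valuation.ne_zero_iff _).1 (by rw [hϖ]; exact WithZero.exp_ne_zero)
  have hvϖ2 : 0 < Valued.v (ϖ ^ 2) := (Valuation.pos_iff _).2 (pow_ne_zero 2 hϖ0)
  have hkey : Valued.v (-(ϖ⁻¹ * ((((n : ↥(cmBorelTriple L 2 v).N) : ↥(unitaryGroupOfForm (conjLocal L (IsCMField.complexConj L) v) (cmLocalForm L 2 v))) : GL (Fin 2) (LocalRing L v)) : Matrix (Fin 2) (Fin 2) (LocalRing L v)) 0 1 w * ϖ⁻¹)) ≤ 1 ↔ Valued.v (((((n : ↥(cmBorelTriple L 2 v).N) : ↥(unitaryGroupOfForm (conjLocal L (IsCMField.complexConj L) v) (cmLocalForm L 2 v))) : GL (Fin 2) (LocalRing L v)) : Matrix (Fin 2) (Fin 2) (LocalRing L v)) 0 1 w) ≤ Valued.v (ϖ ^ 2) := by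
    rw [Valuation.map_neg, show ϖ⁻¹ * ((((n : ↥(cmBorelTriple L 2 v).N) : ↥(unitaryGroupOfForm (conjLocal L (IsCMField.complexConj L) v) (cmLocalForm L 2 v))) : GL (Fin 2) (LocalRing L v)) : Matrix (Fin 2) (Fin 2) (LocalRing L v)) 0 1 w * ϖ⁻¹ = (ϖ ^ 2)⁻¹ * ((((n : ↥(cmBorelTriple L 2 v).N) : ↥(unitaryGroupOfForm (conjLocal L (IsCMField.complexConj L) v) (cmLocalForm L 2 v))) : GL (Fin 2) (LocalRing L v)) : Matrix (Fin 2) (Fin 2) (LocalRing L v)) 0 1 w by rw [pow_two, mul_inv]; ring, Valuation.map_mul, map_inv₀,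
      inv_mul_le_iff₀ hvϖ2, mul_one]
  rw [mem_cmLocalIntegralLevel_iff_forall_v_coe_localNonsplitEquiv_le_one L v w hw, coe_localNonsplitEquiv_flip_conj_unipotent L v w hw ϖ hϖ wf hwf hwf' n]
  constructor
  · intro h; exact hkey.1 (by simpa using h 1 0)
  · intro h i j
    fin_cases i <;> fin_cases j
    · simp
    · simp
    · simpa using hkey.2 h
    · simp

include hw in
/-- **`w♭ n w♭⁻¹ ∈ K♭ ↔ |x_n| ≤ |ϖ|`** (`P♭` of the lower entry: `|ϖ · ϖ⁻² x_n| ≤ 1`). [cite: Tits1979, §3.3.1] [cite: CartierCorvallis1979, §III.5] -/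
theorem flat_flip_conj_unipotent_iff (ϖ : (w.1.adicCompletion L)) (hϖ : Valued.v ϖ = WithZero.exp (-1 : ℤ))
    (wf : ↥(unitaryGroupOfForm (conjLocal L (IsCMField.complexConj L) v) (cmLocalForm L 2 v))) (hwf : ((((localNonsplitEquiv (IsCMField.complexConj L) (Matrix.of fun i j : Fin 2 => if i.val + j.val + 1 = 2 then (1 : L) else 0) (IsCMField.complexConj_ne_one L) w hw) wf : ↥(unitaryGroupOfForm (galAdicCompletionMap (L := L) (IsCMField.complexConj L) hw) (placeForm (Matrix.of fun i j : Fin 2 => if i.val + j.val + 1 = 2 then (1 : L) else 0) w.1))) : GL (Fin 2) (w.1.adicCompletion L)) : Matrix (Fin 2) (Fin 2) (w.1.adicCompletion L)) = !![(0 : (w.1.adicCompletion L)), ϖ; -ϖ⁻¹, 0]) (hwf' : ((((localNonsplitEquiv (IsCMField.complexConj L) (Matrix.of fun i j : Fin 2 => if i.val + j.val + 1 = 2 then (1 : L) else 0) (IsCMField.complexConj_ne_one L) w hw) (wf⁻¹ : ↥(unitaryGroupOfForm (conjLocal L (IsCMField.complexConj L) v) (cmLocalForm L 2 v))) : ↥(unitaryGroupOfForm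 (galAdicCompletionMap (L := L) (IsCMField.complexConj L) hw) (placeForm (Matrix.of fun i j : Fin 2 => if i.val + j.val + 1 = 2 then (1 : L) else 0) w.1))) : GL (Fin 2) (w.1.adicCompletion L)) : Matrix (Fin 2) (Fin 2) (w.1.adicCompletion L)) = !![(0 : (w.1.adicCompletion L)), -ϖ; ϖ⁻¹, 0]) (n : ↥(cmBorelTriple L 2 v).N) :
    (∀ a b : Fin 2, Valued.v (ϖ ^ (a : ℕ) * (ϖ ^ (b : ℕ))⁻¹ * ((((localNonsplitEquiv (IsCMField.complexConj L) (Matrix.of fun i j : Fin 2 => if i.val + j.val + 1 = 2 then (1 : L) else 0) (IsCMField.complexConj_ne_one L) w hw) (wf * ((n : ↥(cmBorelTriple L 2 v).N) : ↥(unitaryGroupOfForm (conjLocal L (IsCMField.complexConj L) v) (cmLocalForm L 2 v))) * wf⁻¹) : ↥(unitaryGroupOfForm (galAdicCompletionMap (L := L) (IsCMField.complexConj L) hw) (placeForm (Matrix.of fun i j : Fin 2 => if i.val + j.val + 1 = 2 then (1 : L) else 0) w.1))) : GL (Fin 2) (w.1.adicCompletion L)) : Matrix (Fin 2) (Fin 2)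 (w.1.adicCompletion L)) a b) ≤ 1) ↔ Valued.v (((((n : ↥(cmBorelTriple L 2 v).N) : ↥(unitaryGroupOfForm (conjLocal L (IsCMField.complexConj L) v) (cmLocalForm L 2 v))) : GL (Fin 2) (LocalRing L v)) : Matrix (Fin 2) (Fin 2) (LocalRing L v)) 0 1 w) ≤ Valued.v ϖ := by
  have hϖ0 : ϖ ≠ 0 := (Valuation.ne_zero_iff _).1 (by rw [hϖ]; exact WithZero.exp_ne_zero)
  have hvϖ : 0 < Valued.v ϖ := (Valuation.pos_iff _).2 hϖ0
  have hkey : Valued.v (ϖ * -(ϖ⁻¹ * ((((n : ↥(cmBorelTriple L 2 v).N) : ↥(unitaryGroupOfForm (conjLocal L (IsCMField.complexConj L) v) (cmLocalForm L 2 v))) : GL (Fin 2) (LocalRing L v)) : Matrix (Fin 2) (Fin 2) (LocalRing L v)) 0 1 w * ϖ⁻¹)) ≤ 1 ↔ Valued.v (((((n : ↥(cmBorelTriple L 2 v).N) : ↥(unitaryGroupOfForm (conjLocal L (IsCMField.complexConj L) v) (cmLocalForm L 2 v))) : GL (Fin 2) (LocalRing L v)) : Matrix (Fin 2) (Fin 2)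 (LocalRing L v)) 0 1 w) ≤ Valued.v ϖ := by
    rw [show ϖ * -(ϖ⁻¹ * ((((n : ↥(cmBorelTriple L 2 v).N) : ↥(unitaryGroupOfForm (conjLocal L (IsCMField.complexConj L) v) (cmLocalForm L 2 v))) : GL (Fin 2) (LocalRing L v)) : Matrix (Fin 2) (Fin 2) (LocalRing L v)) 0 1 w * ϖ⁻¹) = -(ϖ⁻¹ * ((((n : ↥(cmBorelTriple L 2 v).N) : ↥(unitaryGroupOfForm (conjLocal L (IsCMField.complexConj L) v) (cmLocalForm L 2 v))) : GL (Fin 2) (LocalRing L v)) : Matrix (Fin 2) (Fin 2) (LocalRing L v)) 0 1 w) by field_simp, Valuation.map_neg, Valuation.map_mul, map_inv₀, inv_mul_le_iff₀ hvϖ, mul_one]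
  rw [coe_localNonsplitEquiv_flip_conj_unipotent L v w hw ϖ hϖ wf hwf hwf' n]
  constructor
  · intro h
    have h10 := h 1 0
    simp only [Fin.isValue, Fin.val_zero, Fin.val_one, pow_zero, pow_one, inv_one, mul_one, Matrix.of_apply, Matrix.cons_val', Matrix.cons_val_zero,
      Matrix.cons_val_one, Matrix.cons_val_fin_one, Matrix.empty_val'] at h10
    exact hkey.1 h10
  · intro h a b
    fin_cases a <;> fin_cases b
    · simp
    · simp
    · simpa using hkey.2 h
    · simp [hϖ0]
/-! ## §4 The ROW relation on `U(σ_w, antidiag(1,1))`: `κ₁₀ σ(κ₁₁) + κ₁₁ σ(κ₁₀) = 0` -/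

/-- **THE ROW RELATION `κ₁₀σ(κ₁₁) + κ₁₁σ(κ₁₀) = 0`** for `κ ∈ U(σ_w, (Φ₂)_w)`: from `ᵗσ(κ)·Φ·κ = Φ` and `Φ² = 1` one gets `κ·Φ·ᵗσ(κ) = Φ` (a left inverse of a square matrix
is a right inverse), whose `(1,1)` entry is this relation. [cite: Rogawski1990, §1.9–§1.10] -/
theorem apply_one_zero_mul_map_add_eq_zero (u : ↥(unitaryGroupOfForm (galAdicCompletionMap (L := L) (IsCMField.complexConj L) hw) (placeForm (Matrix.of fun i j : Fin 2 => if i.val + j.val + 1 = 2 then (1 : L) else 0) w.1))) :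
    ((u : GL (Fin 2) (w.1.adicCompletion L)) : Matrix (Fin 2) (Fin 2) (w.1.adicCompletion L)) 1 0 * (galAdicCompletionMap (L := L) (IsCMField.complexConj L) hw) (((u : GL (Fin 2) (w.1.adicCompletion L)) : Matrix (Fin 2) (Fin 2) (w.1.adicCompletion L)) 1 1) + ((u : GL (Fin 2) (w.1.adicCompletion L)) : Matrix (Fin 2) (Fin 2) (w.1.adicCompletion L)) 1 1 * (galAdicCompletionMap (L := L) (IsCMField.complexConj L) hw) (((u : GL (Fin 2) (w.1.adicCompletion L)) : Matrix (Fin 2) (Fin 2) (w.1.adicCompletion L)) 1 0) = 0 := by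
  have hU : ((((u : GL (Fin 2) (w.1.adicCompletion L)) : Matrix (Fin 2) (Fin 2) (w.1.adicCompletion L))).map (galAdicCompletionMap (L := L) (IsCMField.complexConj L) hw))ᵀ * !![(0 : (w.1.adicCompletion L)), 1; 1, 0] * ((u : GL (Fin 2) (w.1.adicCompletion L)) : Matrix (Fin 2) (Fin 2) (w.1.adicCompletion L)) = !![(0 : (w.1.adicCompletion L)), 1; 1, 0] :=
    mem_unitaryGroupOfForm_iff.1 (coe_mem_unitaryGroupOfForm_antidiag_two_of_mem_placeForm L w hw u)
  have hΦ2 : !![(0 : (w.1.adicCompletion L)), 1; 1, 0] * !![(0 : (w.1.adicCompletion L)), 1; 1, 0] = 1 := antidiagOne_mul_antidiagOne_two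
  have h1 : (!![(0 : (w.1.adicCompletion L)), 1; 1, 0] * ((((u : GL (Fin 2) (w.1.adicCompletion L)) : Matrix (Fin 2) (Fin 2) (w.1.adicCompletion L))).map (galAdicCompletionMap (L := L) (IsCMField.complexConj L) hw))ᵀ * !![(0 : (w.1.adicCompletion L)), 1; 1, 0]) * ((u : GL (Fin 2) (w.1.adicCompletion L)) : Matrix (Fin 2) (Fin 2) (w.1.adicCompletion L)) = 1 := by
    calc (!![(0 : (w.1.adicCompletion L)), 1; 1, 0] * ((((u : GL (Fin 2) (w.1.adicCompletion L)) : Matrix (Fin 2) (Fin 2) (w.1.adicCompletion L))).map (galAdicCompletionMap (L := L) (IsCMField.complexConj L) hw))ᵀ * !![(0 : (w.1.adicCompletion L)), 1; 1, 0]) * ((u : GL (Fin 2) (w.1.adicCompletion L)) : Matrix (Fin 2) (Fin 2) (w.1.adicCompletion L))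
        = !![(0 : (w.1.adicCompletion L)), 1; 1, 0] * (((((u : GL (Fin 2) (w.1.adicCompletion L)) : Matrix (Fin 2) (Fin 2) (w.1.adicCompletion L))).map (galAdicCompletionMap (L := L) (IsCMField.complexConj L) hw))ᵀ * !![(0 : (w.1.adicCompletion L)), 1; 1, 0] * ((u : GL (Fin 2) (w.1.adicCompletion L)) : Matrix (Fin 2) (Fin 2) (w.1.adicCompletion L))) := by simp only [Matrix.mul_assoc]
      _ = 1 := by rw [hU, hΦ2]
  have h2 : ((u : GL (Fin 2) (w.1.adicCompletion L)) : Matrix (Fin 2) (Fin 2) (w.1.adicCompletion L)) * (!![(0 : (w.1.adicCompletion L)), 1; 1, 0] * ((((u : GL (Fin 2) (w.1.adicCompletion L)) : Matrix (Fin 2) (Fin 2) (w.1.adicCompletion L))).map (galAdicCompletionMap (L := L) (IsCMField.complexConj L) hw))ᵀ * !![(0 : (w.1.adicCompletion L)), 1; 1, 0]) = 1 := mul_eq_one_comm.1 h1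
  have h3 : ((u : GL (Fin 2) (w.1.adicCompletion L)) : Matrix (Fin 2) (Fin 2) (w.1.adicCompletion L)) * !![(0 : (w.1.adicCompletion L)), 1; 1, 0] * ((((u : GL (Fin 2) (w.1.adicCompletion L)) : Matrix (Fin 2) (Fin 2) (w.1.adicCompletion L))).map (galAdicCompletionMap (L := L) (IsCMField.complexConj L) hw))ᵀ = !![(0 : (w.1.adicCompletion L)), 1; 1, 0] := by
    calc ((u : GL (Fin 2) (w.1.adicCompletion L)) : Matrix (Fin 2) (Fin 2) (w.1.adicCompletion L)) * !![(0 : (w.1.adicCompletion L)), 1; 1, 0] * ((((u : GL (Fin 2) (w.1.adicCompletion L)) : Matrix (Fin 2) (Fin 2) (w.1.adicCompletion L))).map (galAdicCompletionMap (L := L) (IsCMField.complexConj L) hw))ᵀ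
        = (((u : GL (Fin 2) (w.1.adicCompletion L)) : Matrix (Fin 2) (Fin 2) (w.1.adicCompletion L)) * (!![(0 : (w.1.adicCompletion L)), 1; 1, 0] * ((((u : GL (Fin 2) (w.1.adicCompletion L)) : Matrix (Fin 2) (Fin 2) (w.1.adicCompletion L))).map (galAdicCompletionMap (L := L) (IsCMField.complexConj L) hw))ᵀ * !![(0 : (w.1.adicCompletion L)), 1; 1, 0])) * !![(0 : (w.1.adicCompletion L)), 1; 1, 0] := by
          simp only [Matrix.mul_assoc, hΦ2, Matrix.mul_one]
      _ = !![(0 : (w.1.adicCompletion L)), 1; 1, 0] := by rw [h2, Matrix.one_mul]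
  have h4 := congrFun (congrFun h3 1) 1
  simp [Matrix.mul_apply, Fin.sum_univ_two] at h4
  linear_combination h4

/-- **`κ₁₁∕κ₁₀` IS SKEW**: `σ(κ₁₁ κ₁₀⁻¹) = −(κ₁₁ κ₁₀⁻¹)` for `κ ∈ U(σ_w, (Φ₂)_w)` with `κ₁₀ ≠ 0`. [cite: Rogawski1990, §1.9–§1.10] -/
theorem map_apply_one_one_mul_inv_eq_neg (u : ↥(unitaryGroupOfForm (galAdicCompletionMap (L := L) (IsCMField.complexConj L) hw) (placeForm (Matrix.of fun i j : Fin 2 => if i.val + j.val + 1 = 2 then (1 : L) else 0) w.1))) (h10 : ((u : GL (Fin 2) (w.1.adicCompletion L)) : Matrix (Fin 2) (Fin 2) (w.1.adicCompletion L)) 1 0 ≠ 0) :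
    (galAdicCompletionMap (L := L) (IsCMField.complexConj L) hw) (((u : GL (Fin 2) (w.1.adicCompletion L)) : Matrix (Fin 2) (Fin 2) (w.1.adicCompletion L)) 1 1 * (((u : GL (Fin 2) (w.1.adicCompletion L)) : Matrix (Fin 2) (Fin 2) (w.1.adicCompletion L)) 1 0)⁻¹) = -(((u : GL (Fin 2) (w.1.adicCompletion L)) : Matrix (Fin 2) (Fin 2) (w.1.adicCompletion L)) 1 1 * (((u : GL (Fin 2) (w.1.adicCompletion L)) : Matrix (Fin 2) (Fin 2) (w.1.adicCompletion L)) 1 0)⁻¹) := by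
  have hrow := apply_one_zero_mul_map_add_eq_zero L v w hw u
  have hσ10 : (galAdicCompletionMap (L := L) (IsCMField.complexConj L) hw) (((u : GL (Fin 2) (w.1.adicCompletion L)) : Matrix (Fin 2) (Fin 2) (w.1.adicCompletion L)) 1 0) ≠ 0 := (map_ne_zero (galAdicCompletionMap (L := L) (IsCMField.complexConj L) hw)).2 h10
  rw [map_mul, map_inv₀, eq_neg_iff_add_eq_zero]
  field_simp
  linear_combination hrow
/-! ## §5 The Bruhat data of `(K♭, K⁰ ⊓ K♭, N, w♭)`: the factorisation `k = i · w♭ · n(x)` off `K⁰`, and `w♭ N ∩ K⁰ = ∅` -/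

include hw in
/-- **OFF `K⁰`, THE `(1,0)` ENTRY IS LARGE**: for `k ∈ K♭ ∖ K⁰`, `|ϖ|⁻¹ ≤ |(E₂k)₁₀|` (the other three entries of `E₂k` are integral by `P♭`; discreteness of `|·|_w`) and
`|(E₂k)₁₀| ≤ |ϖ|⁻¹` (`P♭` itself). [cite: Tits1979, §3.3.1] -/
theorem v_apply_one_zero_of_flat_of_notMem (ϖ : (w.1.adicCompletion L)) (hϖ : Valued.v ϖ = WithZero.exp (-1 : ℤ))
    (K : Subgroup ↥(unitaryGroupOfForm (conjLocal L (IsCMField.complexConj L) v) (cmLocalForm L 2 v))) (hK : ∀ g : ↥(unitaryGroupOfForm (conjLocal L (IsCMField.complexConj L) v) (cmLocalForm L 2 v)), g ∈ K ↔ (∀ a b : Fin 2, Valued.v (ϖ ^ (a : ℕ) * (ϖ ^ (b : ℕ))⁻¹ * ((((localNonsplitEquiv (IsCMField.complexConj L) (Matrix.of fun i j : Fin 2 => if i.val + j.val + 1 = 2 then (1 : L) else 0) (IsCMField.complexConj_ne_one L) w hw) g : ↥(unitaryGroupOfForm (galAdicCompletionMap (L := L) (IsCMField.complexConj L) hw)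 (placeForm (Matrix.of fun i j : Fin 2 => if i.val + j.val + 1 = 2 then (1 : L) else 0) w.1))) : GL (Fin 2) (w.1.adicCompletion L)) : Matrix (Fin 2) (Fin 2) (w.1.adicCompletion L)) a b) ≤ 1)) (k : ↥(unitaryGroupOfForm (conjLocal L (IsCMField.complexConj L) v) (cmLocalForm L 2 v))) (hk : k ∈ K) (hk0 : k ∉ (cmLocalIntegralLevel L 2 (Matrix.of fun i j : Fin 2 => if i.val + j.val + 1 = 2 then (1 : L) else 0) v : Subgroup ↥(unitaryGroupOfForm (conjLocal L (IsCMField.complexConj L) v) (cmLocalForm L 2 v)))) :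
    (Valued.v ϖ)⁻¹ ≤ Valued.v (((((localNonsplitEquiv (IsCMField.complexConj L) (Matrix.of fun i j : Fin 2 => if i.val + j.val + 1 = 2 then (1 : L) else 0) (IsCMField.complexConj_ne_one L) w hw) k : ↥(unitaryGroupOfForm (galAdicCompletionMap (L := L) (IsCMField.complexConj L) hw) (placeForm (Matrix.of fun i j : Fin 2 => if i.val + j.val + 1 = 2 then (1 : L) else 0) w.1))) : GL (Fin 2) (w.1.adicCompletion L)) : Matrix (Fin 2) (Fin 2) (w.1.adicCompletion L)) 1 0) ∧ Valued.v (ϖ * ((((localNonsplitEquiv (IsCMField.complexConj L) (Matrix.of fun i j : Fin 2 => if i.val + j.val + 1 = 2 then (1 : L) else 0) (IsCMField.complexConj_ne_one L) w hw) k : ↥(unitaryGroupOfForm (galAdicCompletionMap (L := L) (IsCMField.complexConj L) hw) (placeForm (Matrix.of fun i j : Fin 2 => if i.val + j.val + 1 = 2 then (1 : L) else 0) w.1))) : GL (Fin 2) (w.1.adicCompletion L)) : Matrix (Fin 2) (Fin 2) (w.1.adicCompletion L)) 1 0) ≤ 1 ∧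
      Valued.v (((((localNonsplitEquiv (IsCMField.complexConj L) (Matrix.of fun i j : Fin 2 => if i.val + j.val + 1 = 2 then (1 : L) else 0) (IsCMField.complexConj_ne_one L) w hw) k : ↥(unitaryGroupOfForm (galAdicCompletionMap (L := L) (IsCMField.complexConj L) hw) (placeForm (Matrix.of fun i j : Fin 2 => if i.val + j.val + 1 = 2 then (1 : L) else 0) w.1))) : GL (Fin 2) (w.1.adicCompletion L)) : Matrix (Fin 2) (Fin 2) (w.1.adicCompletion L)) 0 0) ≤ 1 ∧ Valued.v (((((localNonsplitEquiv (IsCMField.complexConj L) (Matrix.of fun i j : Fin 2 => if i.val + j.val + 1 = 2 then (1 : L) else 0) (IsCMField.complexConj_ne_one L) w hw) k : ↥(unitaryGroupOfForm (galAdicCompletionMap (L := L) (IsCMField.complexConj L) hw) (placeForm (Matrix.of fun i j : Fin 2 => if i.val + j.val + 1 = 2 then (1 : L) else 0) w.1))) : GL (Fin 2) (w.1.adicCompletion L)) : Matrix (Fin 2) (Fin 2) (w.1.adicCompletion L)) 0 1) ≤ Valued.v ϖ ∧ Valued.v (((((localNonsplitEquiv (IsCMField.complexConj L) (Matrix.of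 fun i j : Fin 2 => if i.val + j.val + 1 = 2 then (1 : L) else 0) (IsCMField.complexConj_ne_one L) w hw) k : ↥(unitaryGroupOfForm (galAdicCompletionMap (L := L) (IsCMField.complexConj L) hw) (placeForm (Matrix.of fun i j : Fin 2 => if i.val + j.val + 1 = 2 then (1 : L) else 0) w.1))) : GL (Fin 2) (w.1.adicCompletion L)) : Matrix (Fin 2) (Fin 2) (w.1.adicCompletion L)) 1 1) ≤ 1 := by
  have hϖ0 : ϖ ≠ 0 := (Valuation.ne_zero_iff _).1 (by rw [hϖ]; exact WithZero.exp_ne_zero)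
  have hvϖ : 0 < Valued.v ϖ := (Valuation.pos_iff _).2 hϖ0
  have hϖ1 : Valued.v ϖ ≤ 1 := by rw [hϖ, ← WithZero.exp_zero, WithZero.exp_le_exp]; norm_num
  have hP := (hK k).1 hk
  have h00 : Valued.v (((((localNonsplitEquiv (IsCMField.complexConj L) (Matrix.of fun i j : Fin 2 => if i.val + j.val + 1 = 2 then (1 : L) else 0) (IsCMField.complexConj_ne_one L) w hw) k : ↥(unitaryGroupOfForm (galAdicCompletionMap (L := L) (IsCMField.complexConj L) hw) (placeForm (Matrix.of fun i j : Fin 2 => if i.val + j.val + 1 = 2 then (1 : L) else 0) w.1))) : GL (Fin 2) (w.1.adicCompletion L)) : Matrix (Fin 2) (Fin 2) (w.1.adicCompletion L)) 0 0) ≤ 1 := by simpa using hP 0 0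
  have h11 : Valued.v (((((localNonsplitEquiv (IsCMField.complexConj L) (Matrix.of fun i j : Fin 2 => if i.val + j.val + 1 = 2 then (1 : L) else 0) (IsCMField.complexConj_ne_one L) w hw) k : ↥(unitaryGroupOfForm (galAdicCompletionMap (L := L) (IsCMField.complexConj L) hw) (placeForm (Matrix.of fun i j : Fin 2 => if i.val + j.val + 1 = 2 then (1 : L) else 0) w.1))) : GL (Fin 2) (w.1.adicCompletion L)) : Matrix (Fin 2) (Fin 2) (w.1.adicCompletion L)) 1 1) ≤ 1 := by simpa [hϖ0] using hP 1 1
  have h01 : Valued.v (((((localNonsplitEquiv (IsCMField.complexConj L) (Matrix.of fun i j : Fin 2 => if i.val + j.val + 1 = 2 then (1 : L) else 0) (IsCMField.complexConj_ne_one L) w hw) k : ↥(unitaryGroupOfForm (galAdicCompletionMap (L := L) (IsCMField.complexConj L) hw) (placeForm (Matrix.of fun i j : Fin 2 => if i.val + j.val + 1 = 2 then (1 : L) else 0) w.1))) : GL (Fin 2) (w.1.adicCompletion L)) : Matrix (Fin 2) (Fin 2) (w.1.adicCompletion L)) 0 1) ≤ Valued.v ϖ := by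
    have h := hP 0 1
    simp only [Fin.isValue, Fin.val_zero, Fin.val_one, pow_zero, pow_one, one_mul] at h
    rwa [Valuation.map_mul, map_inv₀, inv_mul_le_iff₀ hvϖ, mul_one] at h
  have h10 : Valued.v (ϖ * ((((localNonsplitEquiv (IsCMField.complexConj L) (Matrix.of fun i j : Fin 2 => if i.val + j.val + 1 = 2 then (1 : L) else 0) (IsCMField.complexConj_ne_one L) w hw) k : ↥(unitaryGroupOfForm (galAdicCompletionMap (L := L) (IsCMField.complexConj L) hw) (placeForm (Matrix.of fun i j : Fin 2 => if i.val + j.val + 1 = 2 then (1 : L) else 0) w.1))) : GL (Fin 2) (w.1.adicCompletion L)) : Matrix (Fin 2) (Fin 2) (w.1.adicCompletion L)) 1 0) ≤ 1 := by simpa using hP 1 0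
  refine ⟨?_, h10, h00, h01, h11⟩
  -- if `|(E₂k)₁₀| ≤ 1` then all entries are integral and `k ∈ K⁰`
  by_contra hlt
  rw [not_le] at hlt
  have hle : ∀ {x : WithZero (Multiplicative ℤ)}, x < 1 → x ≤ WithZero.exp (-1 : ℤ) := fun hx => by
    rw [← WithZero.lt_mul_exp_iff_le WithZero.exp_ne_zero, ← WithZero.exp_add]; simpa using hx
  have h10' : Valued.v (((((localNonsplitEquiv (IsCMField.complexConj L) (Matrix.of fun i j : Fin 2 => if i.val + j.val + 1 = 2 then (1 : L) else 0) (IsCMField.complexConj_ne_one L) w hw) k : ↥(unitaryGroupOfForm (galAdicCompletionMap (L := L) (IsCMField.complexConj L) hw) (placeForm (Matrix.of fun i j : Fin 2 => if i.val + j.val + 1 = 2 then (1 : L) else 0) w.1))) : GL (Fin 2) (w.1.adicCompletion L)) : Matrix (Fin 2) (Fin 2) (w.1.adicCompletion L)) 1 0) ≤ 1 := by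
    -- `v(κ₁₀) < v(ϖ)⁻¹ = exp 1` ⇒ `v(κ₁₀) · exp(-1) < 1` ⇒ `v κ₁₀ · exp(−1) ≤ exp(−1)`, i.e. `v κ₁₀ ≤ 1`
    have h' : Valued.v (((((localNonsplitEquiv (IsCMField.complexConj L) (Matrix.of fun i j : Fin 2 => if i.val + j.val + 1 = 2 then (1 : L) else 0) (IsCMField.complexConj_ne_one L) w hw) k : ↥(unitaryGroupOfForm (galAdicCompletionMap (L := L) (IsCMField.complexConj L) hw) (placeForm (Matrix.of fun i j : Fin 2 => if i.val + j.val + 1 = 2 then (1 : L) else 0) w.1))) : GL (Fin 2) (w.1.adicCompletion L)) : Matrix (Fin 2) (Fin 2) (w.1.adicCompletion L)) 1 0) * Valued.v ϖ < 1 := by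
      calc Valued.v (((((localNonsplitEquiv (IsCMField.complexConj L) (Matrix.of fun i j : Fin 2 => if i.val + j.val + 1 = 2 then (1 : L) else 0) (IsCMField.complexConj_ne_one L) w hw) k : ↥(unitaryGroupOfForm (galAdicCompletionMap (L := L) (IsCMField.complexConj L) hw) (placeForm (Matrix.of fun i j : Fin 2 => if i.val + j.val + 1 = 2 then (1 : L) else 0) w.1))) : GL (Fin 2) (w.1.adicCompletion L)) : Matrix (Fin 2) (Fin 2) (w.1.adicCompletion L)) 1 0) * Valued.v ϖ < (Valued.v ϖ)⁻¹ * Valued.v ϖ := mul_lt_mul_of_pos_right hlt hvϖ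
        _ = 1 := inv_mul_cancel₀ hvϖ.ne'
    have h'' := hle h'
    rw [hϖ] at h''
    have : Valued.v (((((localNonsplitEquiv (IsCMField.complexConj L) (Matrix.of fun i j : Fin 2 => if i.val + j.val + 1 = 2 then (1 : L) else 0) (IsCMField.complexConj_ne_one L) w hw) k : ↥(unitaryGroupOfForm (galAdicCompletionMap (L := L) (IsCMField.complexConj L) hw) (placeForm (Matrix.of fun i j : Fin 2 => if i.val + j.val + 1 = 2 then (1 : L) else 0) w.1))) : GL (Fin 2) (w.1.adicCompletion L)) : Matrix (Fin 2) (Fin 2) (w.1.adicCompletion L)) 1 0) * WithZero.exp (-1 : ℤ) ≤ 1 * WithZero.exp (-1 : ℤ) := by rwa [one_mul]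
    exact le_of_mul_le_mul_right this (by rw [← hϖ]; exact hvϖ)
  exact hk0 ((mem_cmLocalIntegralLevel_iff_forall_v_coe_localNonsplitEquiv_le_one L v w hw k).2 fun i j => by
    fin_cases i <;> fin_cases j
    · exact h00
    · exact h01.trans hϖ1
    · exact h10'
    · exact h11)

set_option maxHeartbeats 1600000 in
-- one `obtain` over a context holding several `E₂`-sized hypotheses is slow at default heartbeats (elaboration cost only)
include hw in
/-- **THE BRUHAT FACTORISATION OFF `K⁰`**: for `k ∈ K♭ ∖ K⁰` there are `i ∈ K⁰ ⊓ K♭` and `n ∈ N ∩ K♭` with `k = i · w♭ · n` — namely `n = n(x)`, `x = (E₂k)₁₁∕(E₂k)₁₀`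
(skew by §4, `|x| ≤ |ϖ|`), `i = k n⁻¹ w♭⁻¹` with `E₂ i = [[−det(E₂k)∕((E₂k)₁₀ϖ), −ϖ(E₂k)₀₀], [0, −ϖ(E₂k)₁₀]]` integral.  This is the `hBr` binder of ★
`index_iwahori_subgroupOf_eq` for `(K♭, K⁰ ⊓ K♭, N, w♭)`. [cite: Tits1979, §3.3.1] [cite: CartierCorvallis1979, §III.5] -/
theorem exists_mem_inf_mul_flip_mul_of_flat_of_notMem (ϖ : (w.1.adicCompletion L)) (hϖ : Valued.v ϖ = WithZero.exp (-1 : ℤ))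
    (K : Subgroup ↥(unitaryGroupOfForm (conjLocal L (IsCMField.complexConj L) v) (cmLocalForm L 2 v))) (hK : ∀ g : ↥(unitaryGroupOfForm (conjLocal L (IsCMField.complexConj L) v) (cmLocalForm L 2 v)), g ∈ K ↔ (∀ a b : Fin 2, Valued.v (ϖ ^ (a : ℕ) * (ϖ ^ (b : ℕ))⁻¹ * ((((localNonsplitEquiv (IsCMField.complexConj L) (Matrix.of fun i j : Fin 2 => if i.val + j.val + 1 = 2 then (1 : L) else 0) (IsCMField.complexConj_ne_one L) w hw) g : ↥(unitaryGroupOfForm (galAdicCompletionMap (L := L) (IsCMField.complexConj L) hw) (placeForm (Matrix.of fun i j : Fin 2 => if i.val + j.val + 1 = 2 then (1 : L) else 0) w.1))) : GL (Fin 2) (w.1.adicCompletion L)) : Matrix (Fin 2) (Fin 2) (w.1.adicCompletion L)) a b) ≤ 1))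
    (wf : ↥(unitaryGroupOfForm (conjLocal L (IsCMField.complexConj L) v) (cmLocalForm L 2 v))) (hwfK : wf ∈ K) (hwf' : ((((localNonsplitEquiv (IsCMField.complexConj L) (Matrix.of fun i j : Fin 2 => if i.val + j.val + 1 = 2 then (1 : L) else 0) (IsCMField.complexConj_ne_one L) w hw) (wf⁻¹ : ↥(unitaryGroupOfForm (conjLocal L (IsCMField.complexConj L) v) (cmLocalForm L 2 v))) : ↥(unitaryGroupOfForm (galAdicCompletionMap (L := L) (IsCMField.complexConj L) hw) (placeForm (Matrix.of fun i j : Fin 2 => if i.val + j.val + 1 = 2 then (1 : L) else 0) w.1))) : GL (Fin 2) (w.1.adicCompletion L)) : Matrix (Fin 2) (Fin 2) (w.1.adicCompletion L)) = !![(0 : (w.1.adicCompletion L)), -ϖ; ϖ⁻¹, 0])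
    (k : ↥(unitaryGroupOfForm (conjLocal L (IsCMField.complexConj L) v) (cmLocalForm L 2 v))) (hk : k ∈ K) (hk0 : k ∉ (cmLocalIntegralLevel L 2 (Matrix.of fun i j : Fin 2 => if i.val + j.val + 1 = 2 then (1 : L) else 0) v : Subgroup ↥(unitaryGroupOfForm (conjLocal L (IsCMField.complexConj L) v) (cmLocalForm L 2 v)))) :
    ∃ i ∈ K ⊓ (cmLocalIntegralLevel L 2 (Matrix.of fun i j : Fin 2 => if i.val + j.val + 1 = 2 then (1 : L) else 0) v : Subgroup ↥(unitaryGroupOfForm (conjLocal L (IsCMField.complexConj L) v) (cmLocalForm L 2 v))), ∃ x ∈ (cmBorelTriple L 2 v).N, x ∈ K ∧ k = i * wf * x := by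
  haveI : Algebra.IsQuadraticExtension ↥(maximalRealSubfield L) L := IsCMField.isQuadraticExtension L
  haveI : Subsingleton (PlacesOver L v) := PlacesOver.subsingleton_of_smul_eq (IsCMField.complexConj L) (IsCMField.complexConj_ne_one L) w hw
  have hϖ0 : ϖ ≠ 0 := (Valuation.ne_zero_iff _).1 (by rw [hϖ]; exact WithZero.exp_ne_zero)
  have hvϖ : 0 < Valued.v ϖ := (Valuation.pos_iff _).2 hϖ0
  have hϖ1 : Valued.v ϖ ≤ 1 := by rw [hϖ, ← WithZero.exp_zero, WithZero.exp_le_exp]; norm_num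
  obtain ⟨hbig, h10, h00, h01, h11⟩ := v_apply_one_zero_of_flat_of_notMem L v w hw ϖ hϖ K hK k hk hk0
  have hκ10 : ((((localNonsplitEquiv (IsCMField.complexConj L) (Matrix.of fun i j : Fin 2 => if i.val + j.val + 1 = 2 then (1 : L) else 0) (IsCMField.complexConj_ne_one L) w hw) k : ↥(unitaryGroupOfForm (galAdicCompletionMap (L := L) (IsCMField.complexConj L) hw) (placeForm (Matrix.of fun i j : Fin 2 => if i.val + j.val + 1 = 2 then (1 : L) else 0) w.1))) : GL (Fin 2) (w.1.adicCompletion L)) : Matrix (Fin 2) (Fin 2) (w.1.adicCompletion L)) 1 0 ≠ 0 := fun h => by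
    rw [h, Valuation.map_zero] at hbig
    exact (lt_irrefl (0 : WithZero (Multiplicative ℤ))) (lt_of_lt_of_le (inv_pos.2 hvϖ) hbig)
  have hdet : Valued.v (((((localNonsplitEquiv (IsCMField.complexConj L) (Matrix.of fun i j : Fin 2 => if i.val + j.val + 1 = 2 then (1 : L) else 0) (IsCMField.complexConj_ne_one L) w hw) k : ↥(unitaryGroupOfForm (galAdicCompletionMap (L := L) (IsCMField.complexConj L) hw) (placeForm (Matrix.of fun i j : Fin 2 => if i.val + j.val + 1 = 2 then (1 : L) else 0) w.1))) : GL (Fin 2) (w.1.adicCompletion L)) : Matrix (Fin 2) (Fin 2) (w.1.adicCompletion L))).det = 1 := v_det_coe_eq_one_of_mem_placeForm L w hw _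
  -- the skew coordinate `x = κ₁₁ κ₁₀⁻¹`, as an element of the semilocal ring
  obtain ⟨kLR, hkLR⟩ : ∃ M : Matrix (Fin 2) (Fin 2) (LocalRing L v), M = ((k : ↥(unitaryGroupOfForm (conjLocal L (IsCMField.complexConj L) v) (cmLocalForm L 2 v))) : GL (Fin 2) (LocalRing L v)).val := ⟨_, rfl⟩
  have hentry : ∀ i j, ((((localNonsplitEquiv (IsCMField.complexConj L) (Matrix.of fun i j : Fin 2 => if i.val + j.val + 1 = 2 then (1 : L) else 0) (IsCMField.complexConj_ne_one L) w hw) k : ↥(unitaryGroupOfForm (galAdicCompletionMap (L := L) (IsCMField.complexConj L) hw) (placeForm (Matrix.of fun i j : Fin 2 => if i.val + j.val + 1 = 2 then (1 : L) else 0) w.1))) : GL (Fin 2) (w.1.adicCompletion L)) : Matrix (Fin 2) (Fin 2) (w.1.adicCompletion L)) i j = kLR i j w := fun _ _ => by rw [hkLR]; rfl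
  obtain ⟨tLR, htLR⟩ : ∃ t : LocalRing L v, t = kLR 1 1 * (kLR 1 0)⁻¹ := ⟨_, rfl⟩
  have htw : tLR w = ((((localNonsplitEquiv (IsCMField.complexConj L) (Matrix.of fun i j : Fin 2 => if i.val + j.val + 1 = 2 then (1 : L) else 0) (IsCMField.complexConj_ne_one L) w hw) k : ↥(unitaryGroupOfForm (galAdicCompletionMap (L := L) (IsCMField.complexConj L) hw) (placeForm (Matrix.of fun i j : Fin 2 => if i.val + j.val + 1 = 2 then (1 : L) else 0) w.1))) : GL (Fin 2) (w.1.adicCompletion L)) : Matrix (Fin 2) (Fin 2) (w.1.adicCompletion L)) 1 1 * (((((localNonsplitEquiv (IsCMField.complexConj L) (Matrix.of fun i j : Fin 2 => if i.val + j.val + 1 = 2 then (1 : L) else 0) (IsCMField.complexConj_ne_one L) w hw) k : ↥(unitaryGroupOfForm (galAdicCompletionMap (L := L) (IsCMField.complexConj L) hw) (placeForm (Matrix.of fun i j : Fin 2 => if i.val + j.val + 1 = 2 then (1 : L) else 0) w.1))) : GL (Fin 2) (w.1.adicCompletion L)) : Matrix (Fin 2) (Fin 2) (w.1.adicCompletion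 L)) 1 0)⁻¹ := by
    rw [htLR, Pi.mul_apply, Pi.inv_apply, hentry, hentry]
  have htskew : tLR ∈ HeisRing.skewPart (conjLocal L (IsCMField.complexConj L) v) := by
    rw [HeisRing.mem_skewPart_iff]
    funext w'
    rw [Subsingleton.elim w' w, conjLocal_apply_eq_of_smul_eq (IsCMField.complexConj L) (IsCMField.complexConj_ne_one L) v w hw, Pi.neg_apply, htw]
    exact map_apply_one_one_mul_inv_eq_neg L v w hw _ hκ10
  obtain ⟨e, he, -⟩ := LineRing.exists_lineChart (conjLocal L (IsCMField.complexConj L) v) (cmLocalForm_eq_over L 2 v)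
  obtain ⟨x, hx⟩ : ∃ x : ↥(cmBorelTriple L 2 v).N, x = e ⟨tLR, htskew⟩ := ⟨_, rfl⟩
  have hxw : ((((x : ↥(cmBorelTriple L 2 v).N) : ↥(unitaryGroupOfForm (conjLocal L (IsCMField.complexConj L) v) (cmLocalForm L 2 v))) : GL (Fin 2) (LocalRing L v)) : Matrix (Fin 2) (Fin 2) (LocalRing L v)) 0 1 w = ((((localNonsplitEquiv (IsCMField.complexConj L) (Matrix.of fun i j : Fin 2 => if i.val + j.val + 1 = 2 then (1 : L) else 0) (IsCMField.complexConj_ne_one L) w hw) k : ↥(unitaryGroupOfForm (galAdicCompletionMap (L := L) (IsCMField.complexConj L) hw) (placeForm (Matrix.of fun i j : Fin 2 => if i.val + j.val + 1 = 2 then (1 : L) else 0) w.1))) : GL (Fin 2) (w.1.adicCompletion L)) : Matrix (Fin 2) (Fin 2) (w.1.adicCompletion L)) 1 1 * (((((localNonsplitEquiv (IsCMField.complexConj L) (Matrix.of fun i j : Fin 2 => if i.val + j.val + 1 = 2 then (1 : L) else 0) (IsCMField.complexConj_ne_one L) w hw) k : ↥(unitaryGroupOfForm (galAdicCompletionMap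 (L := L) (IsCMField.complexConj L) hw) (placeForm (Matrix.of fun i j : Fin 2 => if i.val + j.val + 1 = 2 then (1 : L) else 0) w.1))) : GL (Fin 2) (w.1.adicCompletion L)) : Matrix (Fin 2) (Fin 2) (w.1.adicCompletion L)) 1 0)⁻¹ := by
    rw [hx, he]; exact htw
  have hvx : Valued.v (((((x : ↥(cmBorelTriple L 2 v).N) : ↥(unitaryGroupOfForm (conjLocal L (IsCMField.complexConj L) v) (cmLocalForm L 2 v))) : GL (Fin 2) (LocalRing L v)) : Matrix (Fin 2) (Fin 2) (LocalRing L v)) 0 1 w) ≤ Valued.v ϖ := by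
    rw [hxw, Valuation.map_mul, map_inv₀]
    calc Valued.v (((((localNonsplitEquiv (IsCMField.complexConj L) (Matrix.of fun i j : Fin 2 => if i.val + j.val + 1 = 2 then (1 : L) else 0) (IsCMField.complexConj_ne_one L) w hw) k : ↥(unitaryGroupOfForm (galAdicCompletionMap (L := L) (IsCMField.complexConj L) hw) (placeForm (Matrix.of fun i j : Fin 2 => if i.val + j.val + 1 = 2 then (1 : L) else 0) w.1))) : GL (Fin 2) (w.1.adicCompletion L)) : Matrix (Fin 2) (Fin 2) (w.1.adicCompletion L)) 1 1) * (Valued.v (((((localNonsplitEquiv (IsCMField.complexConj L) (Matrix.of fun i j : Fin 2 => if i.val + j.val + 1 = 2 then (1 : L) else 0) (IsCMField.complexConj_ne_one L) w hw) k : ↥(unitaryGroupOfForm (galAdicCompletionMap (L := L) (IsCMField.complexConj L) hw) (placeForm (Matrix.of fun i j : Fin 2 => if i.val + j.val + 1 = 2 then (1 : L) else 0) w.1))) : GL (Fin 2) (w.1.adicCompletion L)) : Matrix (Fin 2) (Fin 2) (w.1.adicCompletion L)) 1 0))⁻¹ ≤ 1 * (Valued.v ϖ)⁻¹⁻¹ :=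 by
          refine mul_le_mul' h11 ?_
          rw [inv_inv]
          exact inv_le_of_inv_le₀ hvϖ hbig
      _ = Valued.v ϖ := by rw [inv_inv, one_mul]
  have hxK : ((x : ↥(cmBorelTriple L 2 v).N) : ↥(unitaryGroupOfForm (conjLocal L (IsCMField.complexConj L) v) (cmLocalForm L 2 v))) ∈ K := (hK _).2 ((flat_coe_unipotent_iff L v w hw ϖ hϖ x).2 hvx)
  refine ⟨k * (((x : ↥(cmBorelTriple L 2 v).N) : ↥(unitaryGroupOfForm (conjLocal L (IsCMField.complexConj L) v) (cmLocalForm L 2 v))))⁻¹ * wf⁻¹, Subgroup.mem_inf.2 ⟨mul_mem (mul_mem hk (inv_mem hxK)) (inv_mem hwfK), ?_⟩, ((x : ↥(cmBorelTriple L 2 v).N) : ↥(unitaryGroupOfForm (conjLocal L (IsCMField.complexConj L) v) (cmLocalForm L 2 v))), x.2, hxK, by group⟩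
  -- `E₂(k n⁻¹ w♭⁻¹) = κ · [[1, −x], [0, 1]] · [[0, −ϖ], [ϖ⁻¹, 0]]` is integral; name the entries of `κ`
  obtain ⟨a, ha⟩ : ∃ a : (w.1.adicCompletion L), a = ((((localNonsplitEquiv (IsCMField.complexConj L) (Matrix.of fun i j : Fin 2 => if i.val + j.val + 1 = 2 then (1 : L) else 0) (IsCMField.complexConj_ne_one L) w hw) k : ↥(unitaryGroupOfForm (galAdicCompletionMap (L := L) (IsCMField.complexConj L) hw) (placeForm (Matrix.of fun i j : Fin 2 => if i.val + j.val + 1 = 2 then (1 : L) else 0) w.1))) : GL (Fin 2) (w.1.adicCompletion L)) : Matrix (Fin 2) (Fin 2) (w.1.adicCompletion L)) 0 0 := ⟨_, rfl⟩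
  obtain ⟨b, hb⟩ : ∃ b : (w.1.adicCompletion L), b = ((((localNonsplitEquiv (IsCMField.complexConj L) (Matrix.of fun i j : Fin 2 => if i.val + j.val + 1 = 2 then (1 : L) else 0) (IsCMField.complexConj_ne_one L) w hw) k : ↥(unitaryGroupOfForm (galAdicCompletionMap (L := L) (IsCMField.complexConj L) hw) (placeForm (Matrix.of fun i j : Fin 2 => if i.val + j.val + 1 = 2 then (1 : L) else 0) w.1))) : GL (Fin 2) (w.1.adicCompletion L)) : Matrix (Fin 2) (Fin 2) (w.1.adicCompletion L)) 0 1 := ⟨_, rfl⟩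
  obtain ⟨c, hc⟩ : ∃ c : (w.1.adicCompletion L), c = ((((localNonsplitEquiv (IsCMField.complexConj L) (Matrix.of fun i j : Fin 2 => if i.val + j.val + 1 = 2 then (1 : L) else 0) (IsCMField.complexConj_ne_one L) w hw) k : ↥(unitaryGroupOfForm (galAdicCompletionMap (L := L) (IsCMField.complexConj L) hw) (placeForm (Matrix.of fun i j : Fin 2 => if i.val + j.val + 1 = 2 then (1 : L) else 0) w.1))) : GL (Fin 2) (w.1.adicCompletion L)) : Matrix (Fin 2) (Fin 2) (w.1.adicCompletion L)) 1 0 := ⟨_, rfl⟩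
  obtain ⟨d, hd⟩ : ∃ d : (w.1.adicCompletion L), d = ((((localNonsplitEquiv (IsCMField.complexConj L) (Matrix.of fun i j : Fin 2 => if i.val + j.val + 1 = 2 then (1 : L) else 0) (IsCMField.complexConj_ne_one L) w hw) k : ↥(unitaryGroupOfForm (galAdicCompletionMap (L := L) (IsCMField.complexConj L) hw) (placeForm (Matrix.of fun i j : Fin 2 => if i.val + j.val + 1 = 2 then (1 : L) else 0) w.1))) : GL (Fin 2) (w.1.adicCompletion L)) : Matrix (Fin 2) (Fin 2) (w.1.adicCompletion L)) 1 1 := ⟨_, rfl⟩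
  have hη : ((((localNonsplitEquiv (IsCMField.complexConj L) (Matrix.of fun i j : Fin 2 => if i.val + j.val + 1 = 2 then (1 : L) else 0) (IsCMField.complexConj_ne_one L) w hw) k : ↥(unitaryGroupOfForm (galAdicCompletionMap (L := L) (IsCMField.complexConj L) hw) (placeForm (Matrix.of fun i j : Fin 2 => if i.val + j.val + 1 = 2 then (1 : L) else 0) w.1))) : GL (Fin 2) (w.1.adicCompletion L)) : Matrix (Fin 2) (Fin 2) (w.1.adicCompletion L)) = !![a, b; c, d] := by rw [ha, hb, hc, hd]; exact Matrix.eta_fin_two _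
  have hdet' : Valued.v (a * d - b * c) = 1 := by rw [← Matrix.det_fin_two_of, ← hη]; exact hdet
  rw [← hc] at hbig h10 hκ10
  rw [← ha] at h00
  rw [← hd] at h11
  rw [← hc, ← hd] at hxw
  refine (mem_cmLocalIntegralLevel_iff_forall_v_coe_localNonsplitEquiv_le_one L v w hw _).2 ?_
  rw [coe_localNonsplitEquiv_mul, coe_localNonsplitEquiv_mul, Units.val_mul, Units.val_mul, hwf', coe_localNonsplitEquiv_unipotent_inv, hxw, hη]
  have e00 : (!![a, b; c, d] * !![(1 : (w.1.adicCompletion L)), -(d * c⁻¹); 0, 1] * !![(0 : (w.1.adicCompletion L)), -ϖ; ϖ⁻¹, 0]) 0 0 = -(a * d - b * c) * (c⁻¹ * ϖ⁻¹) := by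
    simp [Matrix.mul_apply, Fin.sum_univ_two]; field_simp; ring
  have e01 : (!![a, b; c, d] * !![(1 : (w.1.adicCompletion L)), -(d * c⁻¹); 0, 1] * !![(0 : (w.1.adicCompletion L)), -ϖ; ϖ⁻¹, 0]) 0 1 = -(a * ϖ) := by
    simp [Matrix.mul_apply, Fin.sum_univ_two]
  have e10 : (!![a, b; c, d] * !![(1 : (w.1.adicCompletion L)), -(d * c⁻¹); 0, 1] * !![(0 : (w.1.adicCompletion L)), -ϖ; ϖ⁻¹, 0]) 1 0 = 0 := by
    have hcd : c * (d * c⁻¹) = d := by field_simp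
    simp [Matrix.mul_apply, Fin.sum_univ_two, hcd]
  have e11 : (!![a, b; c, d] * !![(1 : (w.1.adicCompletion L)), -(d * c⁻¹); 0, 1] * !![(0 : (w.1.adicCompletion L)), -ϖ; ϖ⁻¹, 0]) 1 1 = -(c * ϖ) := by
    simp [Matrix.mul_apply, Fin.sum_univ_two]
  intro i j
  fin_cases i <;> fin_cases j
  · show Valued.v ((!![a, b; c, d] * !![(1 : (w.1.adicCompletion L)), -(d * c⁻¹); 0, 1] * !![(0 : (w.1.adicCompletion L)), -ϖ; ϖ⁻¹, 0]) 0 0) ≤ 1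
    rw [e00, Valuation.map_mul, Valuation.map_neg, hdet', one_mul, Valuation.map_mul, map_inv₀, map_inv₀, ← mul_inv,
      inv_le_one₀ (mul_pos (lt_of_lt_of_le (inv_pos.2 hvϖ) hbig) hvϖ)]
    calc (1 : WithZero (Multiplicative ℤ)) = (Valued.v ϖ)⁻¹ * Valued.v ϖ := (inv_mul_cancel₀ hvϖ.ne').symm
      _ ≤ Valued.v c * Valued.v ϖ := mul_le_mul' hbig le_rfl
  · show Valued.v ((!![a, b; c, d] * !![(1 : (w.1.adicCompletion L)), -(d * c⁻¹); 0, 1] * !![(0 : (w.1.adicCompletion L)), -ϖ; ϖ⁻¹, 0]) 0 1) ≤ 1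
    rw [e01, Valuation.map_neg, Valuation.map_mul]
    exact mul_le_one' h00 hϖ1
  · show Valued.v ((!![a, b; c, d] * !![(1 : (w.1.adicCompletion L)), -(d * c⁻¹); 0, 1] * !![(0 : (w.1.adicCompletion L)), -ϖ; ϖ⁻¹, 0]) 1 0) ≤ 1
    rw [e10, Valuation.map_zero]
    exact zero_le_one
  · show Valued.v ((!![a, b; c, d] * !![(1 : (w.1.adicCompletion L)), -(d * c⁻¹); 0, 1] * !![(0 : (w.1.adicCompletion L)), -ϖ; ϖ⁻¹, 0]) 1 1) ≤ 1
    rw [e11, Valuation.map_neg, mul_comm]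
    exact h10

include hw in
/-- **`w♭ · n ∉ K⁰` for `n ∈ N`**: `E₂(w♭ n) = [[0, ϖ], [−ϖ⁻¹, −ϖ⁻¹x_n]]` has the non-integral entry `−ϖ⁻¹`.  This is the `hdisj` binder of ★ `index_iwahori_subgroupOf_eq`.
[cite: Tits1979, §3.3.1] [cite: CartierCorvallis1979, §III.5] -/
theorem flip_mul_coe_notMem_cmLocalIntegralLevel (ϖ : (w.1.adicCompletion L)) (hϖ : Valued.v ϖ = WithZero.exp (-1 : ℤ))
    (wf : ↥(unitaryGroupOfForm (conjLocal L (IsCMField.complexConj L) v) (cmLocalForm L 2 v))) (hwf : ((((localNonsplitEquiv (IsCMField.complexConj L) (Matrix.of fun i j : Fin 2 => if i.val + j.val + 1 = 2 then (1 : L) else 0) (IsCMField.complexConj_ne_one L) w hw) wf : ↥(unitaryGroupOfForm (galAdicCompletionMap (L := L) (IsCMField.complexConj L) hw) (placeForm (Matrix.of fun i j : Fin 2 => if i.val + j.val + 1 = 2 then (1 : L) else 0) w.1))) : GL (Fin 2) (w.1.adicCompletion L)) : Matrix (Fin 2) (Fin 2) (w.1.adicCompletion L)) = !![(0 : (w.1.adicCompletion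 L)), ϖ; -ϖ⁻¹, 0]) (n : ↥(cmBorelTriple L 2 v).N) :
    wf * ((n : ↥(cmBorelTriple L 2 v).N) : ↥(unitaryGroupOfForm (conjLocal L (IsCMField.complexConj L) v) (cmLocalForm L 2 v))) ∉ (cmLocalIntegralLevel L 2 (Matrix.of fun i j : Fin 2 => if i.val + j.val + 1 = 2 then (1 : L) else 0) v : Subgroup ↥(unitaryGroupOfForm (conjLocal L (IsCMField.complexConj L) v) (cmLocalForm L 2 v))) := by
  have hϖ0 : ϖ ≠ 0 := (Valuation.ne_zero_iff _).1 (by rw [hϖ]; exact WithZero.exp_ne_zero)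
  intro h
  have hE10 : ((((localNonsplitEquiv (IsCMField.complexConj L) (Matrix.of fun i j : Fin 2 => if i.val + j.val + 1 = 2 then (1 : L) else 0) (IsCMField.complexConj_ne_one L) w hw) (wf * ((n : ↥(cmBorelTriple L 2 v).N) : ↥(unitaryGroupOfForm (conjLocal L (IsCMField.complexConj L) v) (cmLocalForm L 2 v)))) : ↥(unitaryGroupOfForm (galAdicCompletionMap (L := L) (IsCMField.complexConj L) hw) (placeForm (Matrix.of fun i j : Fin 2 => if i.val + j.val + 1 = 2 then (1 : L) else 0) w.1))) : GL (Fin 2) (w.1.adicCompletion L)) : Matrix (Fin 2) (Fin 2) (w.1.adicCompletion L)) 1 0 = -ϖ⁻¹ := by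
    rw [coe_localNonsplitEquiv_mul, Units.val_mul, hwf, coe_localNonsplitEquiv_unipotent, Matrix.mul_fin_two]
    simp
  have h10 := (mem_cmLocalIntegralLevel_iff_forall_v_coe_localNonsplitEquiv_le_one L v w hw _).1 h 1 0
  rw [hE10, Valuation.map_neg, map_inv₀, hϖ, ← WithZero.exp_neg, neg_neg, ← WithZero.exp_zero, WithZero.exp_le_exp] at h10
  omega

include hw in
/-- **THE DEEPER UNIPOTENTS `N_𝔭`**: for `n = [[1, x_n], [0, 1]] ∈ N`, `w♭ n w♭⁻¹ ∈ K⁰ ⊓ K♭ ↔ |x_n| ≤ |ϖ²|` (§3).  This identifies the subgroup `N_𝔭` of ★ `index_iwahori_subgroupOf_eq`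
for `(K♭, K⁰ ⊓ K♭, N, w♭)` with the ball two steps below `N ∩ K⁰`. [cite: Tits1979, §3.3.1] [cite: CartierCorvallis1979, §III.5] -/
theorem flip_conj_coe_mem_inf_iff (ϖ : (w.1.adicCompletion L)) (hϖ : Valued.v ϖ = WithZero.exp (-1 : ℤ))
    (K : Subgroup ↥(unitaryGroupOfForm (conjLocal L (IsCMField.complexConj L) v) (cmLocalForm L 2 v))) (hK : ∀ g : ↥(unitaryGroupOfForm (conjLocal L (IsCMField.complexConj L) v) (cmLocalForm L 2 v)), g ∈ K ↔ (∀ a b : Fin 2, Valued.v (ϖ ^ (a : ℕ) * (ϖ ^ (b : ℕ))⁻¹ * ((((localNonsplitEquiv (IsCMField.complexConj L) (Matrix.of fun i j : Fin 2 => if i.val + j.val + 1 = 2 then (1 : L) else 0) (IsCMField.complexConj_ne_one L) w hw) g : ↥(unitaryGroupOfForm (galAdicCompletionMap (L := L) (IsCMField.complexConj L) hw) (placeForm (Matrix.of fun i j : Fin 2 => if i.val + j.val + 1 = 2 then (1 : L) else 0) w.1))) : GL (Fin 2) (w.1.adicCompletion L)) : Matrix (Fin 2) (Fin 2) (w.1.adicCompletion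 L)) a b) ≤ 1))
    (wf : ↥(unitaryGroupOfForm (conjLocal L (IsCMField.complexConj L) v) (cmLocalForm L 2 v))) (hwf : ((((localNonsplitEquiv (IsCMField.complexConj L) (Matrix.of fun i j : Fin 2 => if i.val + j.val + 1 = 2 then (1 : L) else 0) (IsCMField.complexConj_ne_one L) w hw) wf : ↥(unitaryGroupOfForm (galAdicCompletionMap (L := L) (IsCMField.complexConj L) hw) (placeForm (Matrix.of fun i j : Fin 2 => if i.val + j.val + 1 = 2 then (1 : L) else 0) w.1))) : GL (Fin 2) (w.1.adicCompletion L)) : Matrix (Fin 2) (Fin 2) (w.1.adicCompletion L)) = !![(0 : (w.1.adicCompletion L)), ϖ; -ϖ⁻¹, 0]) (hwf' : ((((localNonsplitEquiv (IsCMField.complexConj L) (Matrix.of fun i j : Fin 2 => if i.val + j.val + 1 = 2 then (1 : L) else 0) (IsCMField.complexConj_ne_one L) w hw) (wf⁻¹ : ↥(unitaryGroupOfForm (conjLocal L (IsCMField.complexConj L) v) (cmLocalForm L 2 v))) : ↥(unitaryGroupOfForm (galAdicCompletionMap (L := L) (IsCMField.complexConj L) hw) (placeForm (Matrix.of fun i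 j : Fin 2 => if i.val + j.val + 1 = 2 then (1 : L) else 0) w.1))) : GL (Fin 2) (w.1.adicCompletion L)) : Matrix (Fin 2) (Fin 2) (w.1.adicCompletion L)) = !![(0 : (w.1.adicCompletion L)), -ϖ; ϖ⁻¹, 0]) (n : ↥(cmBorelTriple L 2 v).N) :
    wf * ((n : ↥(cmBorelTriple L 2 v).N) : ↥(unitaryGroupOfForm (conjLocal L (IsCMField.complexConj L) v) (cmLocalForm L 2 v))) * wf⁻¹ ∈ K ⊓ (cmLocalIntegralLevel L 2 (Matrix.of fun i j : Fin 2 => if i.val + j.val + 1 = 2 then (1 : L) else 0) v : Subgroup ↥(unitaryGroupOfForm (conjLocal L (IsCMField.complexConj L) v) (cmLocalForm L 2 v))) ↔ Valued.v (((((n : ↥(cmBorelTriple L 2 v).N) : ↥(unitaryGroupOfForm (conjLocal L (IsCMField.complexConj L) v) (cmLocalForm L 2 v))) : GL (Fin 2) (LocalRing L v)) : Matrix (Fin 2) (Fin 2) (LocalRing L v)) 0 1 w) ≤ Valued.v (ϖ ^ 2) := by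
  have hϖ0 : ϖ ≠ 0 := (Valuation.ne_zero_iff _).1 (by rw [hϖ]; exact WithZero.exp_ne_zero)
  have hϖ1 : Valued.v ϖ ≤ 1 := by rw [hϖ, ← WithZero.exp_zero, WithZero.exp_le_exp]; norm_num
  have hϖ2 : Valued.v (ϖ ^ 2) ≤ Valued.v ϖ := by
    rw [pow_two, Valuation.map_mul]; exact mul_le_of_le_one_left zero_le hϖ1
  constructor
  · intro h
    exact (flip_conj_unipotent_mem_cmLocalIntegralLevel_iff L v w hw ϖ hϖ wf hwf hwf' n).1 (Subgroup.mem_inf.1 h).2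
  · intro h
    exact Subgroup.mem_inf.2 ⟨(hK _).2 ((flat_flip_conj_unipotent_iff L v w hw ϖ hϖ wf hwf hwf' n).2 (h.trans hϖ2)),
      (flip_conj_unipotent_mem_cmLocalIntegralLevel_iff L v w hw ϖ hϖ wf hwf hwf' n).2 h⟩

end Literature.NumberTheory.Automorphic.UnitaryGroup
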